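import Literature.Barriers.CriticalPhenomena.SAPAnisotropicNotDFinite242Recurrence
import Mathlib.RingTheory.PowerSeries.WellKnown
import HarnessLib

/-!
# Rechnitzer's Lemma 25 (the 2-4-2 recurrence) from Lemma 23 and the partial fractions (29)/(31):
# building blocks, the Hadamard-product evaluation of Lemma 24, and "no rows of zero length"

Fourth companion of `Literature/Barriers/CriticalPhenomena/SAPAnisotropicNotDFinite.lean`
(A. Rechnitzer, *Haruspicy 2: The anisotropic generating function of self-avoiding polygons is
not D-finite*, J. Combin. Theory Ser. A 113 (2006) 520–546; numbering of arXiv:math/0406450v2).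
The third companion `SAPAnisotropicNotDFinite242Recurrence` vendors **Lemma 25** — the
recurrence `f_{n+1}(s;x) = Σ_{k=0}^{5} c_{k+1} ∂ᵏf_n/∂sᵏ(1;x) + c_7 f_n(s;x) + c_8 f_n(sx;x)`
for the two-variable generating functions `f_n = sap242BGF n ∈ ℚ[s]⟦x⟧` of the 2-4-2 polygons
with `6n-4` vertical bonds (rooted-walk model, `p242Count`) — as the named fact
`Rechnitzer2006_lem25_rec` (cleared of denominators, existential in the unprinted `c_1, …, c_7`,
with the printed `c_8`), on which `Rechnitzer2006_thm16` and the barrier `SAPAnisotropicNotDFinite`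
rest (`Rechnitzer2006_thm16_of_cor13_lem20_lem25`, `Rechnitzer2006_eq38_of_lem25`).

The printed proof of Lemma 25 (§3.3, arXiv pp. 9–11) is: **Lemma 23** — every 2-4-2 polygon is
a unit-height rectangle (the seed) or is obtained in a unique way by gluing a building block (a
2-4-2 polygon of height `3`) under a smaller 2-4-2 polygon along a duplicated 2-bond row, whence
the Hadamard-product equation `f(s;x,y) = ysx/(1-sx) + f(t;x,y) ⊙_t T(t/x,s;x,y)/y` (eq. (28):
`= ysx/(1-sx) + Σ_{n ≥ 1} f_n(x,y) T_n(s;x,y)/(y xⁿ)`), `T(t,s;x,y)` the generating function of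
the building blocks by top row (`t`) and bottom row (`s`) (**Lemma 21** computes it);
**Lemma 24** — `f(t) ⊙_t 1/(1-αt) = f(α)`, `f(t) ⊙_t k! tᵏ/(1-αt)^{k+1} = f^{(k)}(α)`; the partial
fraction form **(29)** of `T(t/x,s;x,y)/y` in `t` (poles at `t = 1` of order `≤ 6`, at `1/s` and at
`1/(sx)`), with the denominators `d_i` of the `c_i` and `c_8` printed in **(31)**; and "where we
have made use of the fact that `[t⁰] f(t;x,y) = 0` (there are no rows of zero length)".

This file formalises that derivation down to two printed statements about the rooted-walk model:

* DEFINITIONS: `topWidth` (the top row of a polygon), `rootedBBCount`/`bbCount m t w` (building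
  blocks = `𝒫^{242}_4` by half-perimeter, top and bottom row, exactly as `rooted242Count 2` with
  the top row recorded), their generating functions `bbGF t = U_t(s;x) = T_t(s;x)/xᵗ` and
  `bbSeries = Σ_t U_t tᵗ = T(t/x,s;x,y)/y⁴ ∈ ℚ[s]⟦x⟧⟦t⟧`, and the kernels of Lemma 24,
  `dfSeries k = Σ_n n(n-1)⋯(n-k+1) tⁿ` (`= k! tᵏ/(1-t)^{k+1}`, `one_sub_pow_mul_dfSeries`) and
  `geomSeries a = Σ aⁿtⁿ` (`= 1/(1-at)`, `one_sub_mul_geomSeries`);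
* NAMED FACTS: `Rechnitzer2006_lem23` (Lemma 23 / eq. (28) as the identity of coefficients of
  `y^{3k+1} s^w x^m`: `p^{242}_{k+1}(m,w) = Σ_{t ≥ 1} Σ_{i+j=m} p^{242}_k(i,t) · bb(j+t,t,w)`) and
  `Rechnitzer2006_eq29` (eq. (29) with (31): `L · 𝒯 = m₀ + Σ_j m_j · j! tʲ/(1-t)^{j+1} +
  m₇/(1-st) + L c_8/(1-sxt)` with polynomial `m`'s, `L = (1-x)^{a+2}(1-sx)^{b+4}(1-s)^c` and the
  printed `c_8`);
* PROOFS: "no rows of zero length" in the rooted-walk model (`rooted242Count_width_zero`,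
  `p242Count_width_zero`: at a lowest vertex of a rooted polygon the two incident bonds cannot
  both be the vertical bond above it — the closing-up makes every vertex both a source and a
  target, `exists_fst_eq_of_mem_darts`); `bbCount_eq_zero_of_lt` (bottom row `≤` half-perimeter,
  from the column parity of the third companion); Lemma 24 in coefficient form
  (`coeff_of_eq29`: `L U_t = Σ_j m_j t(t-1)⋯(t-j+1) + m₇ sᵗ + L c_8 (sx)ᵗ` for `t ≥ 1`;
  `eqBelow_dEvalOne_sap242BGF`, `eqBelow_dilate_sap242BGF`, `eqBelow_sap242BGF`:
  `∂ʲf_n/∂sʲ(1;x)`, `f_n(sx;x)`, `f_n(s;x)` as the sums `Σ_t t(t-1)⋯(t-j+1) f_{n,t}`,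
  `Σ_t f_{n,t} (sx)ᵗ`, `Σ_t f_{n,t} sᵗ` over the slices `f_{n,t}(x) = Σ_m p^{242}_n(m,t) x^m`,
  below any degree); Lemma 23 in series form (`eqBelow_sap242BGF_succ`:
  `f_{k+1} ≡ Σ_t f_{k,t} U_t`); and the assembly
  `Rechnitzer2006_lem25_rec_of_lem23_eq29 : Rechnitzer2006_lem23 → Rechnitzer2006_eq29 →
  Rechnitzer2006_lem25_rec`.

So `Rechnitzer2006_lem25_rec` rests on Lemma 23 (the seed/building-block decomposition, a
statement about 2-4-2 polygons in the rooted-walk model) and on eq. (29)/(31), which is a finite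
computation from the explicit `T̂` of Lemma 21 (whose Taylor coefficients were checked against a
direct enumeration of 3-row 2-4-2 polygons by (half-perimeter, top row, bottom row) up to
half-perimeter `9` — `225` classes, `34488` polygons — and whose partial fraction expansion was
recomputed exactly: `c_8` and `d_7` agree with (31), the common denominator is
`(1-x)³(1-sx)⁶(1-s)⁶`; the printed `(1-s)`-exponents of `d_0, …, d_5` appear shifted by one index,
which is immaterial for the existential statements).

## Eq. (29) from Lemma 21 (appended)

* `bbLem21Cleared s x` — Lemma 21's `T(T/x,s;x,y)/y⁴` (top row conjugate to the outer variable `T`)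
  multiplied by `(1-x)³(1-sx)⁶`, written in `ℤ[s,x]⟦T⟧` through `⟦T⟧ = T/(1-T)`,
  `U = 1/(1-sT) - 1`, `V = 1/(1-sxT) - 1` and the cleared frill polynomials `bbAbar`, `bbBbar`,
  `bbCbar` (`A`, `B`, `C` of Lemma 21); checked against the enumeration of building blocks above;
* `bbLem21Cleared_partialFraction` — its partial fraction expansion in `T` in the shape of eq. (29),
  cleared by `(1-sx)⁵(1-s)⁶`, with the `1/(1-sxT)`-coefficient computed to be the printed `c₈` of
  (31) (generic over a commutative ring; kernels `one_sub_pow_mul_dfSeries`, Lemma 24);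
* `Rechnitzer2006_eq29_of_lem21 : (1-x)³(1-sx)⁶ · bbSeries = bbLem21Cleared s x → Rechnitzer2006_eq29`
  (`d = 6`, `a = 1`, `b = 7`, `c = 6`), so that `Rechnitzer2006_eq29` — hence, with
  `Rechnitzer2006_lem23`, `Rechnitzer2006_lem25_rec` — rests on Lemma 21 for `bbCount` alone.

## Design choices

* Infinite sums over the top-row width `t` (`f_n = Σ_t f_{n,t} sᵗ`, the Hadamard product) are
  handled degree by degree in `x` (`EqBelow K`: agreement of coefficients below `K`): below
  degree `K` only the slices `t < K` matter, because a bottom row is at most the half-perimeter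
  (`p242Count_eq_zero_of_lt`), and the slice `t = 0` vanishes (`p242Count_width_zero`).
* `U_t` is indexed by the half-perimeter minus `t` (`[xʲ] U_t = Σ_w bb(j+t,t,w) s^w`): this is
  the division by `xⁿ` of eq. (28) (`T_n/xⁿ`), legitimate since a top row is at most the
  half-perimeter; Lemma 23 is stated with the same book-keeping (`bbCount (j + t) t w`).
* `Rechnitzer2006_eq29` keeps the printed shape (a `t⁰` term, `d` multiple-pole terms in the
  basis `k! tᵏ/(1-t)^{k+1}`, the two simple poles) and is existential in all numerators but that
  of `c_8` and in the exponents of the common denominator, like `Rechnitzer2006_lem25_rec`.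

## References

* A. Rechnitzer, *Haruspicy 2*, op. cit.: §3.3 — Lemma 21, Definition 22, Lemma 23 and
  eq. (28), Lemma 24, eqs. (29)–(31), Lemma 25 and its proof. [Rechnitzer2006Haruspicy2]
* N. Madras, G. Slade, *The Self-Avoiding Walk*, Birkhäuser 1993: Definition 3.2.1
  (rooted walks vs polygons). [MadrasSlade1993]
-/

noncomputable section

open Finset PowerSeries Literature.Probability.LatticeModels
open scoped BigOperators Polynomial

namespace Literature.Barriers.CriticalPhenomena

/-! ### Building blocks in the rooted-walk model -/

section BuildingBlocks

/-- The width ("length") of the TOP row of a polygon: the number of horizontal bonds on its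
highest line `y = yMax` (the statistic conjugate to `t` in the building-block generating
function `T(t,s;x,y)`). [cite: Rechnitzer2006Haruspicy2, Lemma 21] -/
def topWidth (L : List (Site 2 × Site 2)) : ℕ :=
  L.countP fun b => b.1 1 = yMax L ∧ b.2 1 = yMax L

open Classical in
/-- `2N` times the number of 2-4-2 BUILDING BLOCKS — 2-4-2 polygons of height `3`, i.e. with `8`
vertical bonds (`𝒫^{242}_4`, `k = 2` in `rooted242Count`) — with `2m` horizontal bonds, top row
of width `t` and bottom row of width `w`, `N = 2(m+4)`: the pairs (`e` a neighbour of `0`, `ω` an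
`(N-1)`-step self-avoiding walk `0 → e`) whose polygon has these statistics, exactly as in
`rooted242Count 2 m w` with the top row recorded as well.
[cite: Rechnitzer2006Haruspicy2, §3.3 (seeds and building blocks) and Lemma 21] -/
def rootedBBCount (m t w : ℕ) : ℕ :=
  ∑ e ∈ (zdGraph 2).neighborFinset 0,
    (((zdGraph 2).finsetWalkLength (2 * (m + 4) - 1) (0 : Site 2) e).filter
      fun p => p.IsPath ∧ horizontalSteps p + (if e 1 = 0 then 1 else 0) = 2 * m ∧
        Is242 2 (polygonBonds p) ∧ topWidth (polygonBonds p) = t ∧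
          bottomWidth (polygonBonds p) = w).card

/-- The number of 2-4-2 building blocks (3-row 2-4-2 polygons, up to translation) with
horizontal half-perimeter `m`, top row of width `t` and bottom row of width `w`: the coefficient
of `x^m t^t s^w` in `T(t,s;x,y)/y⁴`. [cite: Rechnitzer2006Haruspicy2, Lemma 21] -/
def bbCount (m t w : ℕ) : ℕ :=
  rootedBBCount m t w / (2 * (2 * (m + 4)))

/-- Recording the top row refines the count of `𝒫^{242}_4`: `rootedBBCount m t w ≤ rooted242Count 2 m w`.
[cite: Rechnitzer2006Haruspicy2, Definition 18 and Lemma 21] -/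
theorem rootedBBCount_le (m t w : ℕ) : rootedBBCount m t w ≤ rooted242Count 2 m w := by
  classical
  rw [rootedBBCount, rooted242Count, if_neg (by omega)]
  refine Finset.sum_le_sum fun e _ => Finset.card_le_card ?_
  intro p
  simp only [Finset.mem_filter]
  rintro ⟨hp, h1, h2, h3, -, h5⟩
  exact ⟨hp, h1, h2, h3, h5⟩

/-- The bottom row of a building block is at most its horizontal half-perimeter:
`bbCount m t w = 0` for `m < w`. [cite: Rechnitzer2006Haruspicy2, Lemma 23] -/
theorem bbCount_eq_zero_of_lt {m t w : ℕ} (h : m < w) : bbCount m t w = 0 := by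
  have := rootedBBCount_le m t w
  rw [rooted242Count_eq_zero_of_lt h, Nat.le_zero] at this
  rw [bbCount, this, Nat.zero_div]

end BuildingBlocks

/-! ### No rows of zero length: `p242Count k m 0 = 0` -/

section NoZeroRows

/-- `yMin` is a lower bound of the ordinates of the sources of the bonds. [folklore] -/
theorem yMin_le_of_mem {L : List (Site 2 × Site 2)} {b : Site 2 × Site 2} (hb : b ∈ L) :
    yMin L ≤ b.1 1 := by
  unfold yMin
  induction L with
  | nil => simp at hb
  | cons a L ih =>
    rw [List.map_cons, List.foldr_cons]
    rcases List.mem_cons.mp hb with rfl | hb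
    · exact min_le_left _ _
    · exact (min_le_right _ _).trans (ih hb)

/-- `yMin` is `0` (the ordinate of the root) or is attained by the source of a bond. [folklore] -/
theorem yMin_eq_zero_or_exists (L : List (Site 2 × Site 2)) :
    yMin L = 0 ∨ ∃ b ∈ L, b.1 1 = yMin L := by
  unfold yMin
  induction L with
  | nil => simp
  | cons a L ih =>
    rw [List.map_cons, List.foldr_cons]
    rcases le_total (a.1 1) ((L.map fun b => b.1 1).foldr min 0) with h | h
    · rw [min_eq_left h]
      exact Or.inr ⟨a, List.mem_cons_self, rfl⟩
    · rw [min_eq_right h]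
      rcases ih with h0 | ⟨b, hb, hb'⟩
      · exact Or.inl h0
      · exact Or.inr ⟨b, List.mem_cons_of_mem _ hb, hb'⟩

/-- In a closed walk every target of a dart is the source of a dart. [folklore] -/
theorem exists_fst_eq_of_mem_darts {V : Type*} {G : SimpleGraph V} {u : V} (c : G.Walk u u)
    {d : G.Dart} (hd : d ∈ c.darts) : ∃ d' ∈ c.darts, d'.fst = d.snd := by
  have h1 := c.map_fst_darts_append
  rw [← c.cons_map_snd_darts] at h1
  -- `fsts ++ [u] = u :: snds`, so `snds ~ fsts`
  have hperm : (c.darts.map (·.snd)).Perm (c.darts.map (·.fst)) := by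
    have : (u :: c.darts.map (·.snd)).Perm (u :: c.darts.map (·.fst)) := by
      rw [← h1]; exact List.perm_append_singleton _ _
    exact (List.perm_cons u).mp this
  have : d.snd ∈ c.darts.map (·.fst) := hperm.subset (List.mem_map_of_mem hd)
  obtain ⟨d', hd', h⟩ := List.mem_map.mp this
  exact ⟨d', hd', h⟩

/-- In a closed walk every source of a dart is the target of a dart. [folklore] -/
theorem exists_snd_eq_of_mem_darts {V : Type*} {G : SimpleGraph V} {u : V} (c : G.Walk u u)
    {d : G.Dart} (hd : d ∈ c.darts) : ∃ d' ∈ c.darts, d'.snd = d.fst := by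
  have h1 := c.map_fst_darts_append
  rw [← c.cons_map_snd_darts] at h1
  have hperm : (c.darts.map (·.fst)).Perm (c.darts.map (·.snd)) := by
    have : (u :: c.darts.map (·.snd)).Perm (u :: c.darts.map (·.fst)) := by
      rw [← h1]; exact List.perm_append_singleton _ _
    exact ((List.perm_cons u).mp this).symm
  have : d.fst ∈ c.darts.map (·.snd) := hperm.subset (List.mem_map_of_mem hd)
  obtain ⟨d', hd', h⟩ := List.mem_map.mp this
  exact ⟨d', hd', h⟩

/-- **No rows of zero length**: the bottom row of a rooted 2-4-2 polygon (indeed of any rooted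
polygon) carries at least one horizontal bond, so `rooted242Count k m 0 = 0`: at a lowest vertex
`v` of the polygon the two incident bonds cannot both be the vertical bond above `v`.
("there are no rows of zero length", `[t⁰] f(t;x,y) = 0`.) [cite: Rechnitzer2006Haruspicy2, proof of Lemma 25 (after eq. (30))] -/
theorem rooted242Count_width_zero (k m : ℕ) : rooted242Count k m 0 = 0 := by
  classical
  rw [rooted242Count]
  split_ifs with hN
  · rfl
  refine Finset.sum_eq_zero fun e he => ?_
  rw [Finset.card_eq_zero, Finset.filter_eq_empty_iff]
  rintro p hp ⟨hpath, -, -, hbot⟩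
  rw [SimpleGraph.mem_neighborFinset] at he
  rw [SimpleGraph.mem_finsetWalkLength_iff] at hp
  have hlen : 2 ≤ p.length := by rw [hp]; omega
  -- the closed walk and its bonds
  set c := p.concat he.symm with hc
  set L := polygonBonds p with hL
  have hcd : c.darts.map SimpleGraph.Dart.toProd = p.darts.map SimpleGraph.Dart.toProd ++ [(e, 0)] := by
    rw [hc, SimpleGraph.Walk.darts_concat, List.concat_eq_append, List.map_append]
    rfl
  have hperm : (c.darts.map SimpleGraph.Dart.toProd).Perm L := by
    rw [hcd, hL, polygonBonds]
    exact List.perm_append_singleton _ _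
  have hmem : ∀ b, b ∈ L ↔ ∃ d ∈ c.darts, d.toProd = b := fun b => by
    rw [← hperm.mem_iff, List.mem_map]
  have hedges : c.edges.Nodup := by
    rw [hc, SimpleGraph.Walk.edges_concat, List.concat_eq_append, List.nodup_append]
    refine ⟨hpath.isTrail.edges_nodup, List.nodup_singleton _, ?_⟩
    intro a ha b hb
    rw [List.mem_singleton] at hb
    subst hb
    exact fun hab => closing_edge_not_mem_edges p hpath hlen (hab ▸ ha)
  -- no horizontal bond at height `yMin`
  have hno : ∀ b ∈ L, ¬ (b.1 1 = yMin L ∧ b.2 1 = yMin L) := by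
    intro b hb hb'
    rw [bottomWidth, List.countP_eq_zero] at hbot
    exact hbot b hb (by simpa using hb')
  -- every endpoint of a bond has ordinate `≥ yMin`
  have hge1 : ∀ d ∈ c.darts, yMin L ≤ d.fst 1 := fun d hd =>
    yMin_le_of_mem ((hmem d.toProd).mpr ⟨d, hd, rfl⟩)
  have hge2 : ∀ d ∈ c.darts, yMin L ≤ d.snd 1 := fun d hd => by
    obtain ⟨d', hd', h⟩ := exists_fst_eq_of_mem_darts c hd
    rw [← h]; exact hge1 d' hd'
  -- a dart whose source is a lowest vertex
  obtain ⟨d₀, hd₀, hv⟩ : ∃ d₀ ∈ c.darts, d₀.fst 1 = yMin L := by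
    rcases yMin_eq_zero_or_exists L with h0 | ⟨b, hb, hb'⟩
    · have hne : p.darts ≠ [] := by
        intro h
        have := congr_arg List.length h
        rw [SimpleGraph.Walk.length_darts, List.length_nil] at this
        omega
      refine ⟨p.darts.head hne, ?_, ?_⟩
      · rw [hc, SimpleGraph.Walk.darts_concat, List.concat_eq_append]
        exact List.mem_append_left _ (List.head_mem hne)
      · have : (p.darts.head hne).fst = 0 := by simp
        rw [this, h0]; rfl
    · obtain ⟨d, hd, rfl⟩ := (hmem b).mp hb
      exact ⟨d, hd, hb'⟩
  obtain ⟨d₁, hd₁, hu⟩ := exists_snd_eq_of_mem_darts c hd₀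
  -- both bonds at `v = d₀.fst` are the vertical bond above `v`
  have hw : d₀.snd 0 = d₀.fst 0 ∧ d₀.snd 1 = d₀.fst 1 + 1 := by
    have hn := hno d₀.toProd ((hmem _).mpr ⟨d₀, hd₀, rfl⟩)
    have h2 := hge2 d₀ hd₀
    rcases adj_cases d₀.adj with ⟨h0, h1⟩ | ⟨h0, h1⟩ | ⟨h0, h1⟩ | ⟨h0, h1⟩
    · exact absurd ⟨hv, h1.trans hv⟩ hn
    · exact absurd ⟨hv, h1.symm.trans hv⟩ hn
    · exact ⟨h0, h1⟩
    · exfalso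
      change yMin L ≤ d₀.toProd.2 1 at h2
      change d₀.toProd.1 1 = yMin L at hv
      omega
  have hu' : d₁.fst 0 = d₀.fst 0 ∧ d₁.fst 1 = d₀.fst 1 + 1 := by
    have hn := hno d₁.toProd ((hmem _).mpr ⟨d₁, hd₁, rfl⟩)
    have h2 := hge1 d₁ hd₁
    have hu1 : d₁.toProd.2 = d₀.toProd.1 := hu
    rcases adj_cases d₁.adj with ⟨h0, h1⟩ | ⟨h0, h1⟩ | ⟨h0, h1⟩ | ⟨h0, h1⟩
    · refine absurd ⟨?_, ?_⟩ hn
      · rw [← h1, hu1]; exact hv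
      · rw [hu1]; exact hv
    · refine absurd ⟨?_, ?_⟩ hn
      · rw [h1, hu1]; exact hv
      · rw [hu1]; exact hv
    · exfalso
      change yMin L ≤ d₁.toProd.1 1 at h2
      rw [hu1] at h1
      change d₀.toProd.1 1 = yMin L at hv
      omega
    · rw [hu1] at h0 h1
      exact ⟨h0, h1⟩
  have heq : d₁.fst = d₀.snd := by
    ext i; fin_cases i
    · exact hu'.1.trans hw.1.symm
    · exact hu'.2.trans hw.2.symm
  -- so they are the same edge, used twice
  have hedge : d₀.edge = d₁.edge := by
    rw [SimpleGraph.Dart.edge, SimpleGraph.Dart.edge, Sym2.eq_swap]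
    exact congrArg₂ (fun a b => s(a, b)) heq.symm hu.symm
  have hsame := List.inj_on_of_nodup_map hedges hd₀ hd₁ hedge
  have : d₀.fst = d₀.snd := by rw [← hu, hsame]
  have h1 := hw.2
  rw [← this] at h1
  omega

/-- Hence `p242Count k m 0 = 0`. [cite: Rechnitzer2006Haruspicy2, proof of Lemma 25] -/
theorem p242Count_width_zero (k m : ℕ) : p242Count k m 0 = 0 := by
  rw [p242Count, rooted242Count_width_zero, Nat.zero_div]

end NoZeroRows

/-! ### Generating functions of building blocks; the series `k! tᵏ/(1-t)^{k+1}` and `1/(1-αt)` -/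

section Series

/-- `U_t(s;x) = T_t(s;x)/xᵗ ∈ ℚ[s]⟦x⟧`: the generating function of the building blocks whose TOP
row has width `t`, by bottom row (`s`) and by horizontal half-perimeter MINUS `t` (`x`):
`[xʲ] U_t = Σ_w bb(j+t, t, w) s^w` (`T_n(s;x,y)`, "the generating function of 2-4-2 building
blocks whose top row has length `n`", carries a factor `xⁿ` — the top row is at most the
half-perimeter, `two_mul_countP_height_le` — which is the factor divided out in
`T_n(s;x,y)/(y xⁿ)` of eq. (28); `w ≤ j + t`, `bbCount_eq_zero_of_lt`).
[cite: Rechnitzer2006Haruspicy2, Lemma 23, eq. (28)] -/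
def bbGF (t : ℕ) : PowerSeries ℚ[X] :=
  PowerSeries.mk fun j => ∑ w ∈ range (j + t + 1),
    Polynomial.C (bbCount (j + t) t w : ℚ) * Polynomial.X ^ w

/-- `𝒯(t) = T(t/x, s; x, y)/y⁴ = Σ_t U_t(s;x) tᵗ ∈ ℚ[s]⟦x⟧⟦t⟧` (outer variable `t`): the
building-block generating function in the form entering the Hadamard product of Lemma 23 and
the partial fraction expansion (29). [cite: Rechnitzer2006Haruspicy2, Lemma 23 and eq. (29)] -/
def bbSeries : PowerSeries (PowerSeries ℚ[X]) :=
  PowerSeries.mk bbGF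

variable {R : Type*} [CommRing R]

variable (R) in
/-- `k! tᵏ/(1-t)^{k+1} = Σ_n n(n-1)⋯(n-k+1) tⁿ`, the kernel of Lemma 24:
`f(t) ⊙_t k! tᵏ/(1-αt)^{k+1} = f^{(k)}(α)` (here `α = 1`). [cite: Rechnitzer2006Haruspicy2, Lemma 24] -/
def dfSeries (k : ℕ) : PowerSeries R :=
  PowerSeries.mk fun n => (n.descFactorial k : R)

/-- `1/(1 - a t) = Σ_n aⁿ tⁿ`, the kernel of Lemma 24: `f(t) ⊙_t 1/(1-αt) = f(α)`.
[cite: Rechnitzer2006Haruspicy2, Lemma 24] -/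
def geomSeries (a : R) : PowerSeries R :=
  PowerSeries.mk fun n => a ^ n

/-- Coefficients of `dfSeries`. [folklore] -/
@[simp] theorem coeff_dfSeries (k n : ℕ) : coeff n (dfSeries R k) = (n.descFactorial k : R) :=
  coeff_mk _ _

/-- Coefficients of `geomSeries`. [folklore] -/
@[simp] theorem coeff_geomSeries (a : R) (n : ℕ) : coeff n (geomSeries a) = a ^ n :=
  coeff_mk _ _

/-- `(1 - a t) · Σ aⁿtⁿ = 1`: `geomSeries a` is `1/(1 - a t)`. [folklore] -/
theorem one_sub_mul_geomSeries (a : R) : (1 - PowerSeries.C a * X) * geomSeries a = 1 := by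
  ext n
  rw [sub_mul, one_mul, map_sub, mul_assoc, coeff_C_mul]
  cases n with
  | zero => simp [geomSeries]
  | succ n => rw [coeff_succ_X_mul, coeff_geomSeries, coeff_geomSeries, coeff_one, if_neg (Nat.succ_ne_zero n), pow_succ']; ring

/-- `(1 - t)^{k+1} · Σ_n n(n-1)⋯(n-k+1) tⁿ = k! tᵏ`: `dfSeries k` is `k! tᵏ/(1-t)^{k+1}`.
[cite: Rechnitzer2006Haruspicy2, Lemma 24] -/
theorem one_sub_pow_mul_dfSeries (k : ℕ) :
    (1 - X) ^ (k + 1) * dfSeries R k = PowerSeries.C (k.factorial : R) * X ^ k := by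
  have h : dfSeries R k =
      PowerSeries.C (k.factorial : R) * (X ^ k * PowerSeries.mk fun n => (Nat.choose (k + n) k : R)) := by
    ext n
    rw [coeff_dfSeries, coeff_C_mul, coeff_X_pow_mul']
    split_ifs with hk
    · rw [coeff_mk, Nat.add_sub_cancel' hk, Nat.descFactorial_eq_factorial_mul_choose]; push_cast; ring
    · rw [mul_zero, Nat.descFactorial_eq_zero_iff_lt.mpr (by omega), Nat.cast_zero]
  rw [h, mul_left_comm, mul_left_comm ((1 - X) ^ (k + 1)), mul_comm ((1 - X) ^ (k + 1)),
    mk_add_choose_mul_one_sub_pow_eq_one, mul_one]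

end Series

/-! ### Lemma 23 (the decomposition) and eq. (29)/(31) (the partial fractions), as named facts -/

section Facts2

/-- **Rechnitzer 2006, Lemma 23** (the seed/building-block decomposition, eq. (28)): "a 2-4-2
polygon is either a rectangle of unit height … or may be constructed by combining a 2-4-2
polygon, whose last row is of length `n` (counted by `f_n(x,y)`) with a 2-4-2 [building block]
whose top row is of length `n` (counted by `T_n(s;x,y)`)", the join of length `n` costing
`1/(y xⁿ)`: `f(s;x,y) = ysx/(1-sx) + Σ_{n ≥ 1} f_n(x,y) T_n(s;x,y)/(y xⁿ)`. Stated as its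
coefficient of `y^{3k+1} s^w x^m`, `k ≥ 1` (the seed only contributes to `y¹`): the number of
2-4-2 polygons with `6(k+1)-4` vertical bonds, horizontal half-perimeter `m` and bottom row `w`
is `Σ_{t ≥ 1} Σ_{i + j = m} p^{242}_k(i, t) · bb(j + t, t, w)` — glue a 2-4-2 polygon with
`6k-4` vertical bonds, half-perimeter `i` and bottom row `t` to a building block with top row
`t`, bottom row `w` and half-perimeter `j + t` along the duplicated row (`p242Count`, `bbCount`
in the rooted-walk model). The printed proof is the decomposition of Figures 9–10 (cut between
each pair of duplicated 2-bond rows). [cite: Rechnitzer2006Haruspicy2, Lemma 23, eq. (28)] -/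
def Rechnitzer2006_lem23 : Prop :=
  ∀ k : ℕ, 1 ≤ k → ∀ m w : ℕ,
    p242Count (k + 1) m w =
      ∑ t ∈ Icc 1 m, ∑ ij ∈ antidiagonal m, p242Count k ij.1 t * bbCount (ij.2 + t) t w

/-- **Rechnitzer 2006, eq. (29) with eq. (31)** (the partial fraction form of the building-block
generating function feeding Lemma 24): "`T(t/x,s;x,y)/y = y³[c_0 · t⁰ + Σ_{k=0}^{5} c_{k+1}
k! tᵏ/(1-t)^{k+1} + c_7/(1-st) + c_8/(1-stx)]`, where the `c_i` are rational functions of `s`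
and `x`", of which the source prints the denominators `d_0 = (1-x)³(1-sx)⁶(1-s)⁶, …,
d_7 = (1-sx)⁶(1-s)⁶` and "`c_8 = -2sx²(s²x²+sx-s+1)/((1-sx)⁴(1-x)²)`" in full (eq. (31)).
Vendored cleared of denominators, existential in the unprinted numerators, in the number `d`
(`= 6`) of multiple-pole terms and in the exponents of the common denominator
`L = (1-x)^{a+2}(1-sx)^{b+4}(1-s)^c` (recomputed: `(1-x)³(1-sx)⁶(1-s)⁶`), with the printed
`c_8` (`c8NumS/((1-sx)⁴(1-x)²)`): in `ℚ[s]⟦x⟧⟦t⟧`,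
`L · 𝒯 = m₀ + Σ_{j<d} m_j · (j! tʲ/(1-t)^{j+1}) + m₇ · 1/(1-st) + L c_8 · 1/(1-sxt)`
(`𝒯 = bbSeries`, `dfSeries`, `geomSeries`). A recomputation of the expansion from Lemma 21
(`cas/pf242.py` of the vendoring session) confirms `c_8` and `d_7` as printed and finds the
`(1-s)`-exponents of `d_0, …, d_5` each shifted by one relative to the print — immaterial here.
[cite: Rechnitzer2006Haruspicy2, eq. (29) and eq. (31)] -/
def Rechnitzer2006_eq29 : Prop :=
  ∃ (d a b c : ℕ) (num : Fin d → ℚ[X][X]) (num₀ num₇ : ℚ[X][X]),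
    PowerSeries.C ((((1 - Polynomial.X) ^ (a + 2) * (1 - sP * Polynomial.X) ^ (b + 4) *
          (1 - sP) ^ c : ℚ[X][X]) : PowerSeries ℚ[X])) * bbSeries =
      PowerSeries.C ((num₀ : PowerSeries ℚ[X]))
        + ∑ j : Fin d, PowerSeries.C ((num j : PowerSeries ℚ[X])) * dfSeries (PowerSeries ℚ[X]) j
        + PowerSeries.C ((num₇ : PowerSeries ℚ[X])) * geomSeries ((sP : ℚ[X][X]) : PowerSeries ℚ[X])
        + PowerSeries.C (((c8NumS * (1 - Polynomial.X) ^ a * (1 - sP * Polynomial.X) ^ b *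
            (1 - sP) ^ c : ℚ[X][X]) : PowerSeries ℚ[X])) *
              geomSeries ((sP * Polynomial.X : ℚ[X][X]) : PowerSeries ℚ[X])

end Facts2

/-! ### Lemma 25 from Lemma 23 and eq. (29) (Lemma 24: evaluating the Hadamard product) -/

section Lemma25

/-- Agreement of two power series below degree `K`. [folklore] -/
def EqBelow {S : Type*} [Semiring S] (K : ℕ) (F G : PowerSeries S) : Prop :=
  ∀ m < K, coeff m F = coeff m G

namespace EqBelow

variable {S : Type*} [CommSemiring S] {K : ℕ}

/-- Reflexivity. [folklore] -/
theorem refl (F : PowerSeries S) : EqBelow K F F := fun _ _ => rfl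

/-- Symmetry. [folklore] -/
theorem symm {F G : PowerSeries S} (h : EqBelow K F G) : EqBelow K G F := fun m hm => (h m hm).symm

/-- Transitivity. [folklore] -/
theorem trans {F G H : PowerSeries S} (h₁ : EqBelow K F G) (h₂ : EqBelow K G H) : EqBelow K F H :=
  fun m hm => (h₁ m hm).trans (h₂ m hm)

/-- Compatibility with addition. [folklore] -/
theorem add {F G F' G' : PowerSeries S} (h : EqBelow K F G) (h' : EqBelow K F' G') :
    EqBelow K (F + F') (G + G') := fun m hm => by rw [map_add, map_add, h m hm, h' m hm]

/-- Compatibility with multiplication (the Cauchy product only uses lower coefficients).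
[folklore] -/
theorem mul_left {F G : PowerSeries S} (h : EqBelow K F G) (P : PowerSeries S) :
    EqBelow K (P * F) (P * G) := fun m hm => by
  rw [coeff_mul, coeff_mul]
  refine Finset.sum_congr rfl fun ij hij => ?_
  rw [mem_antidiagonal] at hij
  rw [h ij.2 (by omega)]

/-- Compatibility with finite sums. [folklore] -/
theorem sum {ι : Type*} (s : Finset ι) {F G : ι → PowerSeries S} (h : ∀ i ∈ s, EqBelow K (F i) (G i)) :
    EqBelow K (∑ i ∈ s, F i) (∑ i ∈ s, G i) := fun m hm => by
  rw [map_sum, map_sum]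
  exact Finset.sum_congr rfl fun i hi => h i hi m hm

end EqBelow

/-- `dilate` only looks at lower coefficients. [folklore] -/
theorem EqBelow.dilate {K : ℕ} {F G : PowerSeries ℚ[X]} (h : EqBelow K F G) :
    EqBelow K (dilate F) (dilate G) := fun m hm =>
  coeff_substHom_congr _ fun i hi => h i (by omega)

/-- Coefficients of `∂ʲ/∂sʲ`. [folklore] -/
theorem coeff_iterate_dS (j : ℕ) (f : PowerSeries ℚ[X]) (m : ℕ) :
    coeff m (dS^[j] f) = Polynomial.derivative^[j] (coeff m f) := by
  induction j generalizing f with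
  | zero => rfl
  | succ j ih => rw [Function.iterate_succ_apply', Function.iterate_succ_apply', coeff_dS, ih]

/-- Coefficient extraction in `ℚ[s]`: `[s^{w₀}] Σ_{w<N} c_w s^w`. [folklore] -/
theorem coeff_sum_C_mul_X_pow (c : ℕ → ℚ) (N w₀ : ℕ) :
    (∑ w ∈ range N, Polynomial.C (c w) * Polynomial.X ^ w).coeff w₀ = if w₀ < N then c w₀ else 0 := by
  rw [Polynomial.finsetSum_coeff]
  simp only [Polynomial.coeff_C_mul_X_pow]
  rw [Finset.sum_ite_eq]
  simp only [Finset.mem_range]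

/-- The slices `f_{k,t}(x) = Σ_m p^{242}_k(m,t) x^m` of `f_k(s;x) = Σ_t f_{k,t}(x) sᵗ`, embedded
in `ℚ[s]⟦x⟧`. [cite: Rechnitzer2006Haruspicy2, Lemma 23] -/
def slice242 (k t : ℕ) : PowerSeries ℚ[X] :=
  PowerSeries.map Polynomial.C (PowerSeries.mk fun m => (p242Count k m t : ℚ))

/-- Coefficients of the slices. [folklore] -/
@[simp] theorem coeff_slice242 (k t m : ℕ) :
    coeff m (slice242 k t) = Polynomial.C (p242Count k m t : ℚ) := by
  simp [slice242]

/-- `f_k ≡ Σ_{1 ≤ t < K} f_{k,t} sᵗ` below degree `K` (no rows of zero length; bottom row at most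
the half-perimeter). [cite: Rechnitzer2006Haruspicy2, Lemma 23] -/
theorem eqBelow_sap242BGF (k K : ℕ) :
    EqBelow K (sap242BGF k) (∑ t ∈ Ico 1 K, slice242 k t * ((sP : ℚ[X][X]) : PowerSeries ℚ[X]) ^ t) := by
  intro m hm
  rw [sap242BGF, coeff_mk, map_sum]
  have hterm : ∀ t, coeff m (slice242 k t * ((sP : ℚ[X][X]) : PowerSeries ℚ[X]) ^ t) =
      Polynomial.C (p242Count k m t : ℚ) * Polynomial.X ^ t := fun t => by
    rw [sP, Polynomial.coe_C, ← map_pow, coeff_mul_C, coeff_slice242]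
  simp_rw [hterm]
  -- `range (m+1) → range K → Ico 1 K`
  rw [Finset.sum_subset (Finset.range_mono (by omega : m + 1 ≤ K))]
  · symm
    refine Finset.sum_subset (fun t ht => ?_) fun t ht hnt => ?_
    · rw [Finset.mem_Ico] at ht; exact Finset.mem_range.mpr ht.2
    · rw [Finset.mem_range] at ht
      have : t = 0 := by rw [Finset.mem_Ico] at hnt; omega
      subst this
      rw [p242Count_width_zero, Nat.cast_zero, map_zero, zero_mul]
  · intro t ht hnt
    rw [Finset.mem_range] at ht hnt
    rw [p242Count_eq_zero_of_lt (by omega), Nat.cast_zero, map_zero, zero_mul]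

/-- Lemma 23 in series form: `f_{k+1} ≡ Σ_{1 ≤ t < K} f_{k,t}(x) · U_t(s;x)` below degree `K`.
[cite: Rechnitzer2006Haruspicy2, Lemma 23, eq. (28)] -/
theorem eqBelow_sap242BGF_succ (h23 : Rechnitzer2006_lem23) {k : ℕ} (hk : 1 ≤ k) (K : ℕ) :
    EqBelow K (sap242BGF (k + 1)) (∑ t ∈ Ico 1 K, slice242 k t * bbGF t) := by
  intro m hm
  rw [sap242BGF, coeff_mk, map_sum]
  simp_rw [coeff_mul, coeff_slice242, bbGF, coeff_mk, h23 k hk m]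
  refine Polynomial.ext fun w₀ => ?_
  push_cast
  rw [coeff_sum_C_mul_X_pow, Polynomial.finsetSum_coeff]
  simp_rw [Polynomial.finsetSum_coeff, Polynomial.coeff_C_mul, coeff_sum_C_mul_X_pow]
  -- restrict `t` to `Icc 1 m`
  rw [← Finset.sum_subset (show Icc 1 m ⊆ Ico 1 K by
    intro t ht; rw [Finset.mem_Icc] at ht; rw [Finset.mem_Ico]; omega)]
  · split_ifs with hw
    · refine Finset.sum_congr rfl fun t ht => Finset.sum_congr rfl fun ij hij => ?_
      rw [mem_antidiagonal] at hij
      by_cases hp : p242Count k ij.1 t = 0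
      · simp [hp]
      by_cases hb : bbCount (ij.2 + t) t w₀ = 0
      · simp [hb]
      have h1 : t ≤ ij.1 := not_lt.mp fun h => hp (p242Count_eq_zero_of_lt h)
      have h2 : w₀ ≤ ij.2 + t := not_lt.mp fun h => hb (bbCount_eq_zero_of_lt h)
      rw [if_pos (by omega)]
    · symm
      refine Finset.sum_eq_zero fun t ht => Finset.sum_eq_zero fun ij hij => ?_
      rw [mem_antidiagonal] at hij
      split_ifs with h
      · by_cases hp : p242Count k ij.1 t = 0
        · simp [hp]
        have h1 : t ≤ ij.1 := not_lt.mp fun h => hp (p242Count_eq_zero_of_lt h)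
        rw [bbCount_eq_zero_of_lt (by omega), Nat.cast_zero, mul_zero]
      · rw [mul_zero]
  · intro t ht hnt
    rw [Finset.mem_Ico] at ht
    rw [Finset.mem_Icc] at hnt
    refine Finset.sum_eq_zero fun ij hij => ?_
    rw [mem_antidiagonal] at hij
    rw [p242Count_eq_zero_of_lt (by omega), Nat.cast_zero, zero_mul]

/-- `(∂ʲf_k/∂sʲ)(1;x) ≡ Σ_{1 ≤ t < K} t(t-1)⋯(t-j+1) · f_{k,t}(x)` below degree `K`: Lemma 24 for
the multiple pole at `t = 1`, `f(t) ⊙_t k! tᵏ/(1-t)^{k+1} = f^{(k)}(1)`.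
[cite: Rechnitzer2006Haruspicy2, Lemma 24] -/
theorem eqBelow_dEvalOne_sap242BGF (k j K : ℕ) :
    EqBelow K (PowerSeries.map Polynomial.C (dEvalOne j (sap242BGF k)))
      (∑ t ∈ Ico 1 K, ((t.descFactorial j : ℕ) : PowerSeries ℚ[X]) * slice242 k t) := by
  intro m hm
  rw [coeff_map, dEvalOne, coeff_evalOne, coeff_iterate_dS, sap242BGF, coeff_mk,
    Polynomial.iterate_derivative_sum, Polynomial.eval_finsetSum, map_sum, map_sum]
  simp_rw [Polynomial.iterate_derivative_C_mul, Polynomial.iterate_derivative_X_pow_eq_C_mul,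
    Polynomial.eval_mul, Polynomial.eval_C, Polynomial.eval_pow, Polynomial.eval_X, one_pow,
    mul_one]
  have hterm : ∀ t, coeff m (((t.descFactorial j : ℕ) : PowerSeries ℚ[X]) * slice242 k t) =
      Polynomial.C ((p242Count k m t : ℚ) * (t.descFactorial j : ℚ)) := fun t => by
    rw [← map_natCast (PowerSeries.C (R := ℚ[X])), coeff_C_mul, coeff_slice242,
      ← map_natCast (Polynomial.C (R := ℚ)), ← map_mul, mul_comm]
  simp_rw [hterm]
  -- `range (m+1) → range K → Ico 1 K`
  rw [Finset.sum_subset (Finset.range_mono (by omega : m + 1 ≤ K))]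
  · symm
    refine Finset.sum_subset (fun t ht => ?_) fun t ht hnt => ?_
    · rw [Finset.mem_Ico] at ht; exact Finset.mem_range.mpr ht.2
    · rw [Finset.mem_range] at ht
      have : t = 0 := by rw [Finset.mem_Ico] at hnt; omega
      subst this
      rw [p242Count_width_zero, Nat.cast_zero, zero_mul, map_zero]
  · intro t ht hnt
    rw [Finset.mem_range] at ht hnt
    rw [p242Count_eq_zero_of_lt (by omega), Nat.cast_zero, zero_mul, map_zero]

/-- `f(sx;x)`: `dilate ↑s = ↑(s x)`. [folklore] -/
theorem dilate_coe_sP : dilate ((sP : ℚ[X][X]) : PowerSeries ℚ[X]) =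
    ((sP * Polynomial.X : ℚ[X][X]) : PowerSeries ℚ[X]) := by
  rw [dilate_coe]
  congr 1
  simp [sP]

/-- `f_k(sx;x) ≡ Σ_{1 ≤ t < K} f_{k,t}(x) (sx)ᵗ` below degree `K`: Lemma 24 for the simple pole
at `t = 1/(sx)`, `f(t) ⊙_t 1/(1-sxt) = f(sx)`. [cite: Rechnitzer2006Haruspicy2, Lemma 24] -/
theorem eqBelow_dilate_sap242BGF (k K : ℕ) :
    EqBelow K (dilate (sap242BGF k))
      (∑ t ∈ Ico 1 K, slice242 k t * ((sP * Polynomial.X : ℚ[X][X]) : PowerSeries ℚ[X]) ^ t) := by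
  refine (eqBelow_sap242BGF k K).dilate.trans fun m _ => ?_
  congr 1
  rw [map_sum]
  refine Finset.sum_congr rfl fun t _ => ?_
  rw [map_mul, map_pow, slice242, dilate_map_C, dilate_coe_sP]

/-- The coefficient of `tᵗ`, `t ≥ 1`, in (the cleared form of) eq. (29):
`L · U_t = Σ_j m_j · t(t-1)⋯(t-j+1) + m₇ sᵗ + m₈ (sx)ᵗ` — Lemma 24 read coefficientwise.
[cite: Rechnitzer2006Haruspicy2, Lemma 24 and eq. (29)] -/
theorem coeff_of_eq29 {d : ℕ} {num : Fin d → ℚ[X][X]} {num₀ num₇ L M₈ : ℚ[X][X]}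
    (h : PowerSeries.C ((L : PowerSeries ℚ[X])) * bbSeries =
      PowerSeries.C ((num₀ : PowerSeries ℚ[X]))
        + ∑ j : Fin d, PowerSeries.C ((num j : PowerSeries ℚ[X])) * dfSeries (PowerSeries ℚ[X]) j
        + PowerSeries.C ((num₇ : PowerSeries ℚ[X])) * geomSeries ((sP : ℚ[X][X]) : PowerSeries ℚ[X])
        + PowerSeries.C ((M₈ : PowerSeries ℚ[X])) *
            geomSeries ((sP * Polynomial.X : ℚ[X][X]) : PowerSeries ℚ[X]))
    {t : ℕ} (ht : 1 ≤ t) :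
    (L : PowerSeries ℚ[X]) * bbGF t =
      ∑ j : Fin d, (num j : PowerSeries ℚ[X]) * ((t.descFactorial j : ℕ) : PowerSeries ℚ[X])
        + (num₇ : PowerSeries ℚ[X]) * ((sP : ℚ[X][X]) : PowerSeries ℚ[X]) ^ t
        + (M₈ : PowerSeries ℚ[X]) * ((sP * Polynomial.X : ℚ[X][X]) : PowerSeries ℚ[X]) ^ t := by
  have := congr_arg (coeff t) h
  rw [coeff_C_mul, bbSeries, coeff_mk] at this
  rw [this, map_add, map_add, map_add, coeff_C, if_neg (by omega), zero_add, map_sum]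
  simp only [coeff_C_mul, coeff_dfSeries, coeff_geomSeries]

/-- Summation of the coefficient identities against the slices `f_{n,t}`: if
`L U_t = Σ_j m_j t(t-1)⋯(t-j+1) + m₇ sᵗ + m₈ (sx)ᵗ` for `t ≥ 1` and Lemma 23 holds, then
`L f_{n+1} = Σ_j m_j ∂ʲf_n/∂sʲ(1;x) + m₇ f_n(s;x) + m₈ f_n(sx;x)` (`[t⁰] f = 0`: "there are no
rows of zero length"). [cite: Rechnitzer2006Haruspicy2, Lemma 25 (proof), eq. (30)] -/
theorem sap242BGF_succ_of_coeff (h23 : Rechnitzer2006_lem23) {d : ℕ} (num : Fin d → ℚ[X][X])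
    (num₇ L M₈ : ℚ[X][X])
    (hstar : ∀ t, 1 ≤ t → (L : PowerSeries ℚ[X]) * bbGF t =
      ∑ j : Fin d, (num j : PowerSeries ℚ[X]) * ((t.descFactorial j : ℕ) : PowerSeries ℚ[X])
        + (num₇ : PowerSeries ℚ[X]) * ((sP : ℚ[X][X]) : PowerSeries ℚ[X]) ^ t
        + (M₈ : PowerSeries ℚ[X]) * ((sP * Polynomial.X : ℚ[X][X]) : PowerSeries ℚ[X]) ^ t)
    {n : ℕ} (hn : 1 ≤ n) :
    (L : PowerSeries ℚ[X]) * sap242BGF (n + 1) =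
      ∑ j : Fin d, (num j : PowerSeries ℚ[X]) *
          PowerSeries.map Polynomial.C (dEvalOne (j : ℕ) (sap242BGF n))
        + (num₇ : PowerSeries ℚ[X]) * sap242BGF n
        + (M₈ : PowerSeries ℚ[X]) * dilate (sap242BGF n) := by
  refine PowerSeries.ext fun M => ?_
  have hMK : M < M + 1 := M.lt_succ_self
  -- the finite expression both sides agree with below degree `M + 1`
  have key : ∀ t ∈ Ico 1 (M + 1), (L : PowerSeries ℚ[X]) * (slice242 n t * bbGF t) =
      slice242 n t * (∑ j : Fin d, (num j : PowerSeries ℚ[X]) *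
          ((t.descFactorial j : ℕ) : PowerSeries ℚ[X])
        + (num₇ : PowerSeries ℚ[X]) * ((sP : ℚ[X][X]) : PowerSeries ℚ[X]) ^ t
        + (M₈ : PowerSeries ℚ[X]) * ((sP * Polynomial.X : ℚ[X][X]) : PowerSeries ℚ[X]) ^ t) := by
    intro t ht
    rw [Finset.mem_Ico] at ht
    rw [mul_left_comm, hstar t ht.1]
  have e1 : ∑ t ∈ Ico 1 (M + 1), slice242 n t * ∑ j : Fin d, (num j : PowerSeries ℚ[X]) *
        ((t.descFactorial j : ℕ) : PowerSeries ℚ[X]) =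
      ∑ j : Fin d, (num j : PowerSeries ℚ[X]) *
        ∑ t ∈ Ico 1 (M + 1), ((t.descFactorial j : ℕ) : PowerSeries ℚ[X]) * slice242 n t := by
    simp_rw [Finset.mul_sum]
    rw [Finset.sum_comm]
    exact Finset.sum_congr rfl fun j _ => Finset.sum_congr rfl fun t _ => by ring
  have e2 : ∑ t ∈ Ico 1 (M + 1), slice242 n t *
        ((num₇ : PowerSeries ℚ[X]) * ((sP : ℚ[X][X]) : PowerSeries ℚ[X]) ^ t) =
      (num₇ : PowerSeries ℚ[X]) *
        ∑ t ∈ Ico 1 (M + 1), slice242 n t * ((sP : ℚ[X][X]) : PowerSeries ℚ[X]) ^ t := by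
    rw [Finset.mul_sum]
    exact Finset.sum_congr rfl fun t _ => by ring
  have e3 : ∑ t ∈ Ico 1 (M + 1), slice242 n t *
        ((M₈ : PowerSeries ℚ[X]) * ((sP * Polynomial.X : ℚ[X][X]) : PowerSeries ℚ[X]) ^ t) =
      (M₈ : PowerSeries ℚ[X]) * ∑ t ∈ Ico 1 (M + 1), slice242 n t *
        ((sP * Polynomial.X : ℚ[X][X]) : PowerSeries ℚ[X]) ^ t := by
    rw [Finset.mul_sum]
    exact Finset.sum_congr rfl fun t _ => by ring
  have hser : (L : PowerSeries ℚ[X]) * ∑ t ∈ Ico 1 (M + 1), slice242 n t * bbGF t =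
      ∑ j : Fin d, (num j : PowerSeries ℚ[X]) *
            ∑ t ∈ Ico 1 (M + 1), ((t.descFactorial j : ℕ) : PowerSeries ℚ[X]) * slice242 n t
        + (num₇ : PowerSeries ℚ[X]) *
            ∑ t ∈ Ico 1 (M + 1), slice242 n t * ((sP : ℚ[X][X]) : PowerSeries ℚ[X]) ^ t
        + (M₈ : PowerSeries ℚ[X]) *
            ∑ t ∈ Ico 1 (M + 1), slice242 n t *
              ((sP * Polynomial.X : ℚ[X][X]) : PowerSeries ℚ[X]) ^ t := by
    rw [Finset.mul_sum, Finset.sum_congr rfl key]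
    simp only [mul_add, Finset.sum_add_distrib]
    rw [e1, e2, e3]
  have hlhs : EqBelow (M + 1) ((L : PowerSeries ℚ[X]) * sap242BGF (n + 1))
      (∑ j : Fin d, (num j : PowerSeries ℚ[X]) *
            ∑ t ∈ Ico 1 (M + 1), ((t.descFactorial j : ℕ) : PowerSeries ℚ[X]) * slice242 n t
        + (num₇ : PowerSeries ℚ[X]) *
            ∑ t ∈ Ico 1 (M + 1), slice242 n t * ((sP : ℚ[X][X]) : PowerSeries ℚ[X]) ^ t
        + (M₈ : PowerSeries ℚ[X]) *
            ∑ t ∈ Ico 1 (M + 1), slice242 n t *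
              ((sP * Polynomial.X : ℚ[X][X]) : PowerSeries ℚ[X]) ^ t) :=
    ((eqBelow_sap242BGF_succ h23 hn (M + 1)).mul_left _).trans fun m _ => by rw [hser]
  have hr1 : EqBelow (M + 1)
      (∑ j : Fin d, (num j : PowerSeries ℚ[X]) *
          PowerSeries.map Polynomial.C (dEvalOne (j : ℕ) (sap242BGF n)))
      (∑ j : Fin d, (num j : PowerSeries ℚ[X]) *
          ∑ t ∈ Ico 1 (M + 1), ((t.descFactorial j : ℕ) : PowerSeries ℚ[X]) * slice242 n t) := by
    refine EqBelow.sum _ fun j _ => ?_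
    exact (eqBelow_dEvalOne_sap242BGF n j (M + 1)).mul_left _
  have hr2 : EqBelow (M + 1) ((num₇ : PowerSeries ℚ[X]) * sap242BGF n)
      ((num₇ : PowerSeries ℚ[X]) *
          ∑ t ∈ Ico 1 (M + 1), slice242 n t * ((sP : ℚ[X][X]) : PowerSeries ℚ[X]) ^ t) :=
    (eqBelow_sap242BGF n (M + 1)).mul_left _
  have hr3 : EqBelow (M + 1) ((M₈ : PowerSeries ℚ[X]) * dilate (sap242BGF n))
      ((M₈ : PowerSeries ℚ[X]) *
          ∑ t ∈ Ico 1 (M + 1), slice242 n t *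
            ((sP * Polynomial.X : ℚ[X][X]) : PowerSeries ℚ[X]) ^ t) :=
    (eqBelow_dilate_sap242BGF n (M + 1)).mul_left _
  have hrhs := (hr1.add hr2).add hr3
  exact (hlhs M hMK).trans (hrhs M hMK).symm

/-- **Lemma 25 (the recurrence) from Lemma 23 and eq. (29)/(31)**, i.e. Rechnitzer's "Apply
Lemma 24 to the partial fraction form of the transition function": with
`f_{n+1}(s;x) = Σ_{t ≥ 1} f_{n,t}(x) U_t(s;x)` (Lemma 23) and
`L U_t = Σ_j m_j t(t-1)⋯(t-j+1) + m₇ sᵗ + L c_8 (sx)ᵗ` for `t ≥ 1` (the coefficient of `tᵗ` in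
eq. (29)), summing against `f_{n,t}` gives `L f_{n+1} = Σ_j m_j ∂ʲf_n/∂sʲ(1;x) + m₇ f_n(s;x) +
L c_8 f_n(sx;x)`, using `[t⁰] f = 0` ("there are no rows of zero length",
`p242Count_width_zero`). [cite: Rechnitzer2006Haruspicy2, Lemma 25 (proof) and eq. (30)] -/
theorem Rechnitzer2006_lem25_rec_of_lem23_eq29 (h23 : Rechnitzer2006_lem23)
    (h29 : Rechnitzer2006_eq29) : Rechnitzer2006_lem25_rec := by
  obtain ⟨d, a, b, c, num, num₀, num₇, h⟩ := h29
  exact ⟨d, a, b, c, num, num₇, fun n hn =>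
    sap242BGF_succ_of_coeff h23 num num₇ _ _ (fun t ht => coeff_of_eq29 h ht) hn⟩

end Lemma25

/-! ## Eq. (29)/(31) from Lemma 21: the partial fraction algebra

The remaining sections reduce `Rechnitzer2006_eq29` to **Lemma 21** (the building-block generating
function as an explicit rational function): `Rechnitzer2006_eq29_of_lem21`. The partial fraction
expansion of eq. (29) is carried out structurally — every `cᵢ` but `c₈` stays existential, and the
coefficient of `1/(1-stx)` is tracked exactly through the two terms of `T` carrying the factor
`⟦stx²⟧` — so that no "very large" numerator is ever written down. -/
section PFAlgebra

variable {R : Type*} [CommRing R]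

/-- `(1 - T) · Σₙ Tⁿ = 1`: `dfSeries R 0` is `1/(1-T)`. [folklore] -/
theorem one_sub_X_mul_dfSeries_zero : (1 - X : PowerSeries R) * dfSeries R 0 = 1 := by
  have h := one_sub_pow_mul_dfSeries (R := R) 0
  simpa using h

/-- `Σₙ 1ⁿ Tⁿ = Σₙ Tⁿ`. [folklore] -/
theorem geomSeries_one : geomSeries (1 : R) = dfSeries R 0 := by
  ext n; simp

/-- `T/(1-T) = 1/(1-T) - 1`. [folklore] -/
theorem X_mul_dfSeries_zero : (X : PowerSeries R) * dfSeries R 0 = dfSeries R 0 - 1 := by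
  ext n
  cases n with
  | zero =>
    rw [PowerSeries.coeff_zero_X_mul, map_sub, coeff_dfSeries, coeff_one, if_pos rfl]
    simp
  | succ n =>
    rw [coeff_succ_X_mul, coeff_dfSeries, map_sub, coeff_dfSeries, coeff_one,
      if_neg (Nat.succ_ne_zero n)]
    simp

/-- Cancellation of the unit `1 - T` of `R⟦T⟧`. [folklore] -/
theorem cancel_one_sub_X {F G : PowerSeries R} (h : (1 - X) * F = (1 - X) * G) : F = G := by
  have key : ∀ H : PowerSeries R, dfSeries R 0 * ((1 - X) * H) = H := fun H => by
    rw [← mul_assoc, mul_comm (dfSeries R 0), one_sub_X_mul_dfSeries_zero, one_mul]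
  rw [← key F, h, key]

/-- Cancellation of the unit `(1 - T)ⁿ`. [folklore] -/
theorem cancel_one_sub_X_pow {F G : PowerSeries R} (n : ℕ)
    (h : (1 - X) ^ n * F = (1 - X) ^ n * G) : F = G := by
  induction n generalizing F G with
  | zero => simpa using h
  | succ n ih =>
    apply ih
    apply cancel_one_sub_X
    rw [← mul_assoc, ← mul_assoc, ← pow_succ', h]

/-- Cancellation of the unit `1 - aT`. [folklore] -/
theorem cancel_one_sub_C_mul_X {F G : PowerSeries R} (a : R)
    (h : (1 - PowerSeries.C a * X) * F = (1 - PowerSeries.C a * X) * G) : F = G := by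
  have key : ∀ H : PowerSeries R, geomSeries a * ((1 - PowerSeries.C a * X) * H) = H := fun H => by
    rw [← mul_assoc, mul_comm (geomSeries a), one_sub_mul_geomSeries, one_mul]
  rw [← key F, h, key]

/-- Lemma 24's kernel identity `t · d/dt`: `(j+1) · (T/(1-T)) · j!Tʲ/(1-T)^{j+1} = (j+1)! T^{j+1}/(1-T)^{j+2}`,
i.e. `Σₙ (Σ_{i<n} i(i-1)⋯(i-j+1)) Tⁿ · (j+1) = Σₙ n(n-1)⋯(n-j) Tⁿ`. [cite: Rechnitzer2006Haruspicy2, Lemma 24] -/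
theorem succ_mul_X_mul_dfSeries_mul_dfSeries (j : ℕ) :
    ((j + 1 : ℕ) : PowerSeries R) * (X * dfSeries R 0 * dfSeries R j) = dfSeries R (j + 1) := by
  apply cancel_one_sub_X_pow (j + 2)
  have h1 := one_sub_pow_mul_dfSeries (R := R) j
  have h2 := one_sub_pow_mul_dfSeries (R := R) (j + 1)
  have h0 := one_sub_X_mul_dfSeries_zero (R := R)
  calc (1 - X) ^ (j + 2) * (((j + 1 : ℕ) : PowerSeries R) * (X * dfSeries R 0 * dfSeries R j))
      = ((j + 1 : ℕ) : PowerSeries R) * X * ((1 - X) * dfSeries R 0) *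
          ((1 - X) ^ (j + 1) * dfSeries R j) := by ring
    _ = ((j + 1 : ℕ) : PowerSeries R) * X * (PowerSeries.C (j.factorial : R) * X ^ j) := by
        rw [h0, h1, mul_one]
    _ = PowerSeries.C ((j + 1).factorial : R) * X ^ (j + 1) := by
        rw [Nat.factorial_succ, Nat.cast_mul, map_mul, pow_succ]
        simp only [map_natCast]
        ring
    _ = (1 - X) ^ (j + 2) * dfSeries R (j + 1) := h2.symm

/-- Lemma 24 at the simple pole `1/a` against the pole at `1`:
`(1-a) · T/(1-T) · 1/(1-aT) = 1/(1-T) - 1/(1-aT)`. [cite: Rechnitzer2006Haruspicy2, Lemma 24] -/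
theorem X_mul_dfSeries_mul_geomSeries (a : R) :
    PowerSeries.C (1 - a) * (X * dfSeries R 0 * geomSeries a) = dfSeries R 0 - geomSeries a := by
  apply cancel_one_sub_X
  apply cancel_one_sub_C_mul_X a
  have h0 := one_sub_X_mul_dfSeries_zero (R := R)
  have ha := one_sub_mul_geomSeries a
  calc (1 - PowerSeries.C a * X) * ((1 - X) * (PowerSeries.C (1 - a) * (X * dfSeries R 0 * geomSeries a)))
      = PowerSeries.C (1 - a) * X * ((1 - X) * dfSeries R 0) * ((1 - PowerSeries.C a * X) * geomSeries a) := by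
        ring
    _ = PowerSeries.C (1 - a) * X := by rw [h0, ha]; ring
    _ = (1 - PowerSeries.C a * X) * ((1 - X) * dfSeries R 0) -
          (1 - X) * ((1 - PowerSeries.C a * X) * geomSeries a) := by
        rw [h0, ha, map_sub, map_one]; ring
    _ = (1 - PowerSeries.C a * X) * ((1 - X) * (dfSeries R 0 - geomSeries a)) := by ring

/-- The two simple poles: `(1-x)/((1-aT)(1-axT)) = 1/(1-aT) - x/(1-axT)`. [folklore] -/
theorem geomSeries_mul_geomSeries (a x : R) :
    PowerSeries.C (1 - x) * (geomSeries a * geomSeries (a * x)) =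
      geomSeries a - PowerSeries.C x * geomSeries (a * x) := by
  apply cancel_one_sub_C_mul_X a
  apply cancel_one_sub_C_mul_X (a * x)
  have ha := one_sub_mul_geomSeries a
  have hax := one_sub_mul_geomSeries (a * x)
  calc (1 - PowerSeries.C (a * x) * X) * ((1 - PowerSeries.C a * X) *
        (PowerSeries.C (1 - x) * (geomSeries a * geomSeries (a * x))))
      = PowerSeries.C (1 - x) * ((1 - PowerSeries.C a * X) * geomSeries a) *
          ((1 - PowerSeries.C (a * x) * X) * geomSeries (a * x)) := by ring
    _ = PowerSeries.C (1 - x) := by rw [ha, hax]; ring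
    _ = (1 - PowerSeries.C (a * x) * X) * ((1 - PowerSeries.C a * X) * geomSeries a) -
          PowerSeries.C x * (1 - PowerSeries.C a * X) *
            ((1 - PowerSeries.C (a * x) * X) * geomSeries (a * x)) := by
        rw [ha, hax, map_sub, map_one, map_mul]; ring
    _ = (1 - PowerSeries.C (a * x) * X) * ((1 - PowerSeries.C a * X) *
          (geomSeries a - PowerSeries.C x * geomSeries (a * x))) := by ring

/-- Partial fractions of `(T/(1-T))^α / (1-aT)`, cleared by `(1-a)^α`: a polynomial in `T/(1-T)`
plus `(-1)^α/(1-aT)`. [cite: Rechnitzer2006Haruspicy2, eq. (29)] -/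
theorem X_mul_dfSeries_pow_mul_geomSeries (a : R) (α : ℕ) :
    ∃ q : R[X], PowerSeries.C ((1 - a) ^ α) * ((X * dfSeries R 0) ^ α * geomSeries a) =
      q.eval₂ PowerSeries.C (X * dfSeries R 0) + PowerSeries.C ((-1) ^ α) * geomSeries a := by
  induction α with
  | zero => exact ⟨0, by simp⟩
  | succ α ih =>
    obtain ⟨q, hq⟩ := ih
    refine ⟨Polynomial.C (1 - a) * Polynomial.X * q + Polynomial.C ((-1) ^ α) * (1 + Polynomial.X), ?_⟩
    have h3 := X_mul_dfSeries_mul_geomSeries a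
    calc PowerSeries.C ((1 - a) ^ (α + 1)) * ((X * dfSeries R 0) ^ (α + 1) * geomSeries a)
        = PowerSeries.C (1 - a) * (X * dfSeries R 0) *
            (PowerSeries.C ((1 - a) ^ α) * ((X * dfSeries R 0) ^ α * geomSeries a)) := by
          rw [pow_succ, pow_succ, map_mul]; ring
      _ = PowerSeries.C (1 - a) * (X * dfSeries R 0) * (q.eval₂ PowerSeries.C (X * dfSeries R 0)) +
            PowerSeries.C ((-1) ^ α) * (PowerSeries.C (1 - a) * (X * dfSeries R 0 * geomSeries a)) := by
          rw [hq]; ring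
      _ = _ := by
          rw [h3]
          simp only [Polynomial.eval₂_add, Polynomial.eval₂_mul, Polynomial.eval₂_C,
            Polynomial.eval₂_X, Polynomial.eval₂_one]
          simp only [map_mul, map_pow, map_neg, map_one, pow_succ]
          rw [X_mul_dfSeries_zero]
          ring


/-! ### Sums of monomials in `T/(1-T)` against the simple poles -/

/-- `Σ_{α ≤ n} c_α (T/(1-T))^α · 1/(1-bT)`, cleared by `(1-b)ⁿ`: a polynomial in `T/(1-T)` plus an
EXPLICIT multiple of `1/(1-bT)`. [cite: Rechnitzer2006Haruspicy2, eq. (29)] -/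
theorem sum_X_mul_dfSeries_pow_mul_geomSeries (b : R) (n : ℕ) (c : ℕ → R) :
    ∃ q : R[X], PowerSeries.C ((1 - b) ^ n) *
        ((∑ α ∈ range (n + 1), PowerSeries.C (c α) * (X * dfSeries R 0) ^ α) * geomSeries b) =
      q.eval₂ PowerSeries.C (X * dfSeries R 0) +
        PowerSeries.C (∑ α ∈ range (n + 1), c α * (1 - b) ^ (n - α) * (-1) ^ α) * geomSeries b := by
  suffices h : ∀ S : Finset ℕ, (∀ α ∈ S, α ≤ n) → ∃ q : R[X], PowerSeries.C ((1 - b) ^ n) *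
        ((∑ α ∈ S, PowerSeries.C (c α) * (X * dfSeries R 0) ^ α) * geomSeries b) =
      q.eval₂ PowerSeries.C (X * dfSeries R 0) +
        PowerSeries.C (∑ α ∈ S, c α * (1 - b) ^ (n - α) * (-1) ^ α) * geomSeries b from
    h _ fun α hα => Nat.lt_succ_iff.mp (Finset.mem_range.mp hα)
  intro S hS
  induction S using Finset.induction_on with
  | empty => exact ⟨0, by simp⟩
  | insert α S hαS ih =>
    obtain ⟨q, hq⟩ := ih fun β hβ => hS β (Finset.mem_insert_of_mem hβ)
    obtain ⟨k, hk⟩ : ∃ k, n = α + k := Nat.exists_eq_add_of_le (hS α (Finset.mem_insert_self α S))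
    obtain ⟨q₁, h₁⟩ := X_mul_dfSeries_pow_mul_geomSeries b α
    refine ⟨Polynomial.C (c α * (1 - b) ^ k) * q₁ + q, ?_⟩
    rw [Finset.sum_insert hαS, Finset.sum_insert hαS, add_mul, mul_add, hq, hk,
      Nat.add_sub_cancel_left]
    have e : PowerSeries.C ((1 - b) ^ (α + k)) *
          (PowerSeries.C (c α) * (X * dfSeries R 0) ^ α * geomSeries b) =
        PowerSeries.C (c α * (1 - b) ^ k) *
          (PowerSeries.C ((1 - b) ^ α) * ((X * dfSeries R 0) ^ α * geomSeries b)) := by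
      simp only [map_mul, map_pow, pow_add]; ring
    rw [e, h₁]
    simp only [Polynomial.eval₂_add, Polynomial.eval₂_mul, Polynomial.eval₂_C]
    simp only [map_add, map_mul, map_pow, map_neg, map_one, map_sum]
    ring

/-- A polynomial `P` in `T/(1-T)` of degree `≤ n` against `U = aT/(1-aT) = 1/(1-aT) - 1`, cleared
by `(1-a)ⁿ`: a polynomial in `T/(1-T)` plus a multiple of `1/(1-aT)` (Lemma 24: the multiple pole
at `1` and the simple pole at `1/a`). [cite: Rechnitzer2006Haruspicy2, eq. (29)] -/
theorem sum_pow_mul_geomSeries_sub_one (a : R) (n : ℕ) (c : ℕ → R) :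
    ∃ (q : R[X]) (m₇ : R), PowerSeries.C ((1 - a) ^ n) *
        ((∑ α ∈ range (n + 1), PowerSeries.C (c α) * (X * dfSeries R 0) ^ α) *
          (geomSeries a - 1)) =
      q.eval₂ PowerSeries.C (X * dfSeries R 0) + PowerSeries.C m₇ * geomSeries a := by
  obtain ⟨q₁, h₁⟩ := sum_X_mul_dfSeries_pow_mul_geomSeries a n c
  refine ⟨q₁ - Polynomial.C ((1 - a) ^ n) *
      ∑ α ∈ range (n + 1), Polynomial.C (c α) * Polynomial.X ^ α,
    ∑ α ∈ range (n + 1), c α * (1 - a) ^ (n - α) * (-1) ^ α, ?_⟩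
  rw [mul_sub, mul_one, mul_sub, h₁, Polynomial.eval₂_sub, Polynomial.eval₂_mul,
    Polynomial.eval₂_C, Polynomial.eval₂_finsetSum]
  simp only [Polynomial.eval₂_mul, Polynomial.eval₂_C, Polynomial.eval₂_pow, Polynomial.eval₂_X]
  ring

/-- The same for a polynomial given abstractly, with a degree bound. [cite: Rechnitzer2006Haruspicy2, eq. (29)] -/
theorem eval₂_mul_geomSeries_sub_one (a : R) (n : ℕ) (p : R[X]) (hp : p.natDegree ≤ n) :
    ∃ (q : R[X]) (m₇ : R), PowerSeries.C ((1 - a) ^ n) *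
        (p.eval₂ PowerSeries.C (X * dfSeries R 0) * (geomSeries a - 1)) =
      q.eval₂ PowerSeries.C (X * dfSeries R 0) + PowerSeries.C m₇ * geomSeries a := by
  have hsum : p.eval₂ PowerSeries.C (X * dfSeries R 0) =
      ∑ α ∈ range (n + 1), PowerSeries.C (p.coeff α) * (X * dfSeries R 0) ^ α := by
    conv_lhs => rw [p.as_sum_range' (n + 1) (Nat.lt_succ_of_le hp)]
    rw [Polynomial.eval₂_finsetSum]
    simp only [Polynomial.eval₂_monomial]
  rw [hsum]
  exact sum_pow_mul_geomSeries_sub_one a n p.coeff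

/-- A polynomial `P = Σ_{α ≤ n} c_α (T/(1-T))^α` against `U·V`, `U = 1/(1-aT) - 1`,
`V = 1/(1-axT) - 1`, cleared by `(1-x)(1-a)ⁿ(1-ax)ⁿ`: a polynomial in `T/(1-T)`, a multiple of
`1/(1-aT)`, and an EXPLICIT multiple of `1/(1-axT)` — the book-keeping of `c₈`.
[cite: Rechnitzer2006Haruspicy2, eqs. (29), (31)] -/
theorem sum_pow_mul_geomSeries_sub_one_mul (a x : R) (n : ℕ) (c : ℕ → R) :
    ∃ (q : R[X]) (m₇ : R), PowerSeries.C ((1 - a) ^ n * (1 - a * x) ^ n) *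
        (PowerSeries.C (1 - x) *
          (∑ α ∈ range (n + 1), PowerSeries.C (c α) * (X * dfSeries R 0) ^ α) *
            (geomSeries a - 1) * (geomSeries (a * x) - 1)) =
      q.eval₂ PowerSeries.C (X * dfSeries R 0) + PowerSeries.C m₇ * geomSeries a +
        PowerSeries.C (-((1 - a) ^ n *
          ∑ α ∈ range (n + 1), c α * (1 - a * x) ^ (n - α) * (-1) ^ α)) * geomSeries (a * x) := by
  obtain ⟨q₁, h₁⟩ := sum_X_mul_dfSeries_pow_mul_geomSeries a n c
  obtain ⟨q₂, h₂⟩ := sum_X_mul_dfSeries_pow_mul_geomSeries (a * x) n c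
  have h7 := geomSeries_mul_geomSeries a x
  set P := ∑ α ∈ range (n + 1), PowerSeries.C (c α) * (X * dfSeries R 0) ^ α with hP
  have hPq : P = (∑ α ∈ range (n + 1), Polynomial.C (c α) * Polynomial.X ^ α).eval₂
      PowerSeries.C (X * dfSeries R 0) := by
    rw [hP, Polynomial.eval₂_finsetSum]
    simp only [Polynomial.eval₂_mul, Polynomial.eval₂_C, Polynomial.eval₂_pow, Polynomial.eval₂_X]
  refine ⟨Polynomial.C (x * (1 - a * x) ^ n) * q₁ - Polynomial.C ((1 - a) ^ n) * q₂ +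
      Polynomial.C ((1 - x) * (1 - a) ^ n * (1 - a * x) ^ n) *
        (∑ α ∈ range (n + 1), Polynomial.C (c α) * Polynomial.X ^ α),
    x * (1 - a * x) ^ n * (∑ α ∈ range (n + 1), c α * (1 - a) ^ (n - α) * (-1) ^ α), ?_⟩
  have hUV : PowerSeries.C (1 - x) * ((geomSeries a - 1) * (geomSeries (a * x) - 1)) =
      PowerSeries.C x * geomSeries a - geomSeries (a * x) + PowerSeries.C (1 - x) := by
    have : PowerSeries.C (1 - x) * ((geomSeries a - 1) * (geomSeries (a * x) - 1)) =
        PowerSeries.C (1 - x) * (geomSeries a * geomSeries (a * x)) -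
          PowerSeries.C (1 - x) * geomSeries a -
          PowerSeries.C (1 - x) * geomSeries (a * x) + PowerSeries.C (1 - x) := by ring
    rw [this, h7, map_sub, map_one]; ring
  calc PowerSeries.C ((1 - a) ^ n * (1 - a * x) ^ n) *
        (PowerSeries.C (1 - x) * P * (geomSeries a - 1) * (geomSeries (a * x) - 1))
      = PowerSeries.C ((1 - a) ^ n * (1 - a * x) ^ n) * P *
          (PowerSeries.C (1 - x) * ((geomSeries a - 1) * (geomSeries (a * x) - 1))) := by ring
    _ = PowerSeries.C (x * (1 - a * x) ^ n) * (PowerSeries.C ((1 - a) ^ n) * (P * geomSeries a))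
        - PowerSeries.C ((1 - a) ^ n) * (PowerSeries.C ((1 - a * x) ^ n) * (P * geomSeries (a * x)))
        + PowerSeries.C ((1 - x) * (1 - a) ^ n * (1 - a * x) ^ n) * P := by
          rw [hUV]; simp only [map_mul, map_pow, map_sub, map_one]; ring
    _ = _ := by
          rw [h₁, h₂, hPq]
          simp only [Polynomial.eval₂_add, Polynomial.eval₂_sub, Polynomial.eval₂_mul,
            Polynomial.eval₂_C]
          simp only [map_mul, map_pow, map_sub, map_neg, map_one, map_sum]
          ring


/-! ### Book-keeping of the shape `q(T/(1-T)) + m₇/(1-aT) + m₈/(1-axT)` -/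

/-- Weakening the clearing factor. [folklore] -/
theorem pf_shape_weaken {L m a x : R} {F : PowerSeries R} (p : R)
    (h : ∃ (q : R[X]) (m₇ : R), PowerSeries.C L * F =
      q.eval₂ PowerSeries.C (X * dfSeries R 0) + PowerSeries.C m₇ * geomSeries a +
        PowerSeries.C m * geomSeries (a * x)) :
    ∃ (q : R[X]) (m₇ : R), PowerSeries.C (p * L) * F =
      q.eval₂ PowerSeries.C (X * dfSeries R 0) + PowerSeries.C m₇ * geomSeries a +
        PowerSeries.C (p * m) * geomSeries (a * x) := by
  obtain ⟨q, m₇, h⟩ := h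
  refine ⟨Polynomial.C p * q, p * m₇, ?_⟩
  rw [map_mul, mul_assoc, h]
  simp only [Polynomial.eval₂_mul, Polynomial.eval₂_C, map_mul]
  ring

/-- Constant multiples. [folklore] -/
theorem pf_shape_const_mul {L m a x : R} {F : PowerSeries R} (p : R)
    (h : ∃ (q : R[X]) (m₇ : R), PowerSeries.C L * F =
      q.eval₂ PowerSeries.C (X * dfSeries R 0) + PowerSeries.C m₇ * geomSeries a +
        PowerSeries.C m * geomSeries (a * x)) :
    ∃ (q : R[X]) (m₇ : R), PowerSeries.C L * (PowerSeries.C p * F) =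
      q.eval₂ PowerSeries.C (X * dfSeries R 0) + PowerSeries.C m₇ * geomSeries a +
        PowerSeries.C (p * m) * geomSeries (a * x) := by
  obtain ⟨q, m₇, h⟩ := h
  refine ⟨Polynomial.C p * q, p * m₇, ?_⟩
  rw [mul_left_comm, h]
  simp only [Polynomial.eval₂_mul, Polynomial.eval₂_C, map_mul]
  ring

/-- Sums. [folklore] -/
theorem pf_shape_add {L m m' a x : R} {F G : PowerSeries R}
    (hF : ∃ (q : R[X]) (m₇ : R), PowerSeries.C L * F =
      q.eval₂ PowerSeries.C (X * dfSeries R 0) + PowerSeries.C m₇ * geomSeries a +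
        PowerSeries.C m * geomSeries (a * x))
    (hG : ∃ (q : R[X]) (m₇ : R), PowerSeries.C L * G =
      q.eval₂ PowerSeries.C (X * dfSeries R 0) + PowerSeries.C m₇ * geomSeries a +
        PowerSeries.C m' * geomSeries (a * x)) :
    ∃ (q : R[X]) (m₇ : R), PowerSeries.C L * (F + G) =
      q.eval₂ PowerSeries.C (X * dfSeries R 0) + PowerSeries.C m₇ * geomSeries a +
        PowerSeries.C (m + m') * geomSeries (a * x) := by
  obtain ⟨q, m₇, h⟩ := hF
  obtain ⟨q', m₇', h'⟩ := hG
  refine ⟨q + q', m₇ + m₇', ?_⟩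
  rw [mul_add, h, h']
  simp only [Polynomial.eval₂_add, map_add]
  ring

/-- Polynomials in `T/(1-T)` have the shape (no poles but `1`). [folklore] -/
theorem pf_shape_eval₂ (L a x : R) (p : R[X]) :
    ∃ (q : R[X]) (m₇ : R), PowerSeries.C L * p.eval₂ PowerSeries.C (X * dfSeries R 0) =
      q.eval₂ PowerSeries.C (X * dfSeries R 0) + PowerSeries.C m₇ * geomSeries a +
        PowerSeries.C 0 * geomSeries (a * x) :=
  ⟨Polynomial.C L * p, 0, by simp [Polynomial.eval₂_mul, Polynomial.eval₂_C]⟩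

/-- Terms without the pole at `1/(ax)`. [folklore] -/
theorem pf_shape_of_no_last {L a : R} (x : R) {F : PowerSeries R}
    (h : ∃ (q : R[X]) (m₇ : R), PowerSeries.C L * F =
      q.eval₂ PowerSeries.C (X * dfSeries R 0) + PowerSeries.C m₇ * geomSeries a) :
    ∃ (q : R[X]) (m₇ : R), PowerSeries.C L * F =
      q.eval₂ PowerSeries.C (X * dfSeries R 0) + PowerSeries.C m₇ * geomSeries a +
        PowerSeries.C 0 * geomSeries (a * x) := by
  obtain ⟨q, m₇, h⟩ := h
  exact ⟨q, m₇, by rw [h, map_zero, zero_mul, add_zero]⟩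

/-- Rewriting the clearing factor. [folklore] -/
theorem pf_shape_L_eq {L L' m a x : R} {F : PowerSeries R} (hL : L = L')
    (h : ∃ (q : R[X]) (m₇ : R), PowerSeries.C L * F =
      q.eval₂ PowerSeries.C (X * dfSeries R 0) + PowerSeries.C m₇ * geomSeries a +
        PowerSeries.C m * geomSeries (a * x)) :
    ∃ (q : R[X]) (m₇ : R), PowerSeries.C L' * F =
      q.eval₂ PowerSeries.C (X * dfSeries R 0) + PowerSeries.C m₇ * geomSeries a +
        PowerSeries.C m * geomSeries (a * x) := hL ▸ h

/-! ### Change of coefficient ring -/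

/-- `dfSeries` is natural. [folklore] -/
theorem map_dfSeries {S : Type*} [CommRing S] (f : R →+* S) (k : ℕ) :
    PowerSeries.map f (dfSeries R k) = dfSeries S k := by
  ext n; simp [coeff_map]

/-- `geomSeries` is natural. [folklore] -/
theorem map_geomSeries {S : Type*} [CommRing S] (f : R →+* S) (a : R) :
    PowerSeries.map f (geomSeries a) = geomSeries (f a) := by
  ext n; simp [coeff_map]

end PFAlgebra

/-! ### Polynomials in `T/(1-T)` are finite combinations of the `j! Tʲ/(1-T)^{j+1}` -/

section FinForm

variable {R : Type*} [CommRing R]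

/-- Padding a finite `dfSeries`-combination with zero coefficients. [folklore] -/
theorem dfSeries_sum_pad {F : PowerSeries R} {d d' : ℕ} (hd : d ≤ d') {e : ℕ → R} {e₀ : R}
    (h : F = PowerSeries.C e₀ + ∑ j ∈ range d, PowerSeries.C (e j) * dfSeries R j) :
    F = PowerSeries.C e₀ +
      ∑ j ∈ range d', PowerSeries.C (if j < d then e j else 0) * dfSeries R j := by
  rw [h, ← Finset.sum_subset (Finset.range_mono hd)]
  · congr 1
    exact Finset.sum_congr rfl fun j hj => by rw [if_pos (Finset.mem_range.mp hj)]
  · intro j _ hj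
    rw [if_neg (by simpa using hj), map_zero, zero_mul]

/-- Sums of finite `dfSeries`-combinations. [folklore] -/
theorem dfSeries_sum_add {F G : PowerSeries R} {d d' : ℕ} {e e' : ℕ → R} {e₀ e₀' : R}
    (hF : F = PowerSeries.C e₀ + ∑ j ∈ range d, PowerSeries.C (e j) * dfSeries R j)
    (hG : G = PowerSeries.C e₀' + ∑ j ∈ range d', PowerSeries.C (e' j) * dfSeries R j) :
    ∃ (f : ℕ → R) (f₀ : R),
      F + G = PowerSeries.C f₀ + ∑ j ∈ range (max d d'), PowerSeries.C (f j) * dfSeries R j := by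
  refine ⟨fun j => (if j < d then e j else 0) + (if j < d' then e' j else 0), e₀ + e₀', ?_⟩
  rw [dfSeries_sum_pad (le_max_left d d') hF, dfSeries_sum_pad (le_max_right d d') hG]
  simp only [map_add, add_mul, Finset.sum_add_distrib]
  ring

variable [Algebra ℚ R]

/-- `T/(1-T) · j!Tʲ/(1-T)^{j+1} = (j+1)⁻¹ · (j+1)! T^{j+1}/(1-T)^{j+2}` over a `ℚ`-algebra.
[cite: Rechnitzer2006Haruspicy2, Lemma 24] -/
theorem X_mul_dfSeries_mul_dfSeries (j : ℕ) :
    X * dfSeries R 0 * dfSeries R j =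
      PowerSeries.C (algebraMap ℚ R ((j + 1 : ℚ)⁻¹)) * dfSeries R (j + 1) := by
  have h := succ_mul_X_mul_dfSeries_mul_dfSeries (R := R) j
  have hc : ((j + 1 : ℕ) : PowerSeries R) = PowerSeries.C (algebraMap ℚ R (j + 1 : ℚ)) := by
    rw [← map_natCast (PowerSeries.C (R := R)), ← map_natCast (algebraMap ℚ R), Nat.cast_succ]
  rw [← h, hc, ← mul_assoc, ← map_mul, ← map_mul,
    inv_mul_cancel₀ (by positivity : (j + 1 : ℚ) ≠ 0), map_one, map_one, one_mul]

/-- `T/(1-T)` times a finite `dfSeries`-combination. [cite: Rechnitzer2006Haruspicy2, Lemma 24] -/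
theorem dfSeries_sum_mul {F : PowerSeries R} {d : ℕ} {e : ℕ → R} {e₀ : R}
    (hF : F = PowerSeries.C e₀ + ∑ j ∈ range d, PowerSeries.C (e j) * dfSeries R j) :
    ∃ (f : ℕ → R) (f₀ : R),
      X * dfSeries R 0 * F = PowerSeries.C f₀ + ∑ j ∈ range (d + 1), PowerSeries.C (f j) * dfSeries R j := by
  refine ⟨fun | 0 => e₀ | i + 1 => algebraMap ℚ R ((i + 1 : ℚ)⁻¹) * e i, -e₀, ?_⟩
  rw [hF, mul_add, Finset.mul_sum, Finset.sum_range_succ']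
  dsimp only
  have h1 : ∀ j ∈ range d, X * dfSeries R 0 * (PowerSeries.C (e j) * dfSeries R j) =
      PowerSeries.C (algebraMap ℚ R ((j + 1 : ℚ)⁻¹) * e j) * dfSeries R (j + 1) := by
    intro j _
    rw [mul_left_comm, X_mul_dfSeries_mul_dfSeries, map_mul]
    ring
  rw [Finset.sum_congr rfl h1, mul_comm (X * dfSeries R 0) (PowerSeries.C e₀),
    X_mul_dfSeries_zero, map_neg]
  ring

/-- Powers of `T/(1-T)` are finite `dfSeries`-combinations. [cite: Rechnitzer2006Haruspicy2, Lemma 24] -/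
theorem exists_dfSeries_sum_pow (n : ℕ) :
    ∃ (e : ℕ → R) (e₀ : R),
      (X * dfSeries R 0) ^ n = PowerSeries.C e₀ + ∑ j ∈ range n, PowerSeries.C (e j) * dfSeries R j := by
  induction n with
  | zero => exact ⟨0, 1, by simp⟩
  | succ n ih =>
    obtain ⟨e, e₀, h⟩ := ih
    obtain ⟨f, f₀, hf⟩ := dfSeries_sum_mul h
    exact ⟨f, f₀, by rw [pow_succ, mul_comm, hf]⟩

/-- Polynomials in `T/(1-T)` are finite `dfSeries`-combinations (the basis `k! tᵏ/(1-t)^{k+1}`,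
`k = 0, …, 5` of eq. (29), together with `t⁰`). [cite: Rechnitzer2006Haruspicy2, eq. (29)] -/
theorem exists_dfSeries_sum_eval₂ (q : R[X]) :
    ∃ (d : ℕ) (e : ℕ → R) (e₀ : R), q.eval₂ PowerSeries.C (X * dfSeries R 0) =
      PowerSeries.C e₀ + ∑ j ∈ range d, PowerSeries.C (e j) * dfSeries R j := by
  induction q using Polynomial.induction_on' with
  | add p q hp hq =>
    obtain ⟨d, e, e₀, h⟩ := hp
    obtain ⟨d', e', e₀', h'⟩ := hq
    obtain ⟨f, f₀, hf⟩ := dfSeries_sum_add h h'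
    exact ⟨_, f, f₀, by rw [Polynomial.eval₂_add, hf]⟩
  | monomial n a =>
    obtain ⟨e, e₀, h⟩ := exists_dfSeries_sum_pow (R := R) n
    refine ⟨n, fun j => a * e j, a * e₀, ?_⟩
    rw [Polynomial.eval₂_monomial, h, mul_add, Finset.mul_sum]
    simp only [map_mul, mul_assoc]

/-- The same in the `Fin`-indexed form of `Rechnitzer2006_eq29`. [cite: Rechnitzer2006Haruspicy2, eq. (29)] -/
theorem exists_fin_sum_eval₂ (q : R[X]) :
    ∃ (d : ℕ) (num : Fin d → R) (num₀ : R), q.eval₂ PowerSeries.C (X * dfSeries R 0) =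
      PowerSeries.C num₀ + ∑ j : Fin d, PowerSeries.C (num j) * dfSeries R j := by
  obtain ⟨d, e, e₀, h⟩ := exists_dfSeries_sum_eval₂ q
  exact ⟨d, fun j => e j, e₀, by rw [h, ← Finset.sum_range fun j => PowerSeries.C (e j) * dfSeries R j]⟩

end FinForm

/-! ### Lemma 21 (the building-block generating function), cleared of denominators -/

section Lemma21

variable {R : Type*} [CommRing R]

/-- `Ā = (1-x)(1-sx)² · A(s, T/x; x)` as a polynomial in `T/(1-T)`, where
`A(s,t;x) = 1 + ⟦x⟧ + 2⟦sx⟧ + 2⟦tx⟧ + ⟦sx⟧⟦tx⟧ + ⟦sx⟧² + ⟦sx⟧⟦x⟧ + ⟦tx⟧² + ⟦tx⟧⟦x⟧`, `⟦f⟧ = f/(1-f)`,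
is the `A`-frill generating function of Lemma 21 (so `⟦tx⟧ ↦ ⟦T⟧ = T/(1-T) = X * dfSeries R 0`,
`⟦x⟧ = x/(1-x)`, `⟦sx⟧ = sx/(1-sx)`): `Ā = ā₀ + ā₁ ⟦T⟧ + ā₂ ⟦T⟧²` with
`ā₀ = (1-x)(1-sx)² + x(1-sx)² + 2sx(1-x)(1-sx) + s²x²(1-x) + sx²(1-sx)`,
`ā₁ = 2(1-x)(1-sx)² + sx(1-x)(1-sx) + x(1-sx)²`, `ā₂ = (1-x)(1-sx)²`. (`A` is symmetric in `s, t`.)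
[cite: Rechnitzer2006Haruspicy2, Lemma 21] -/
def bbAbar (s x : R) : PowerSeries R :=
  PowerSeries.C ((1 - x) * (1 - s * x) ^ 2 + x * (1 - s * x) ^ 2 + 2 * s * x * (1 - x) * (1 - s * x) +
      s ^ 2 * x ^ 2 * (1 - x) + s * x ^ 2 * (1 - s * x)) +
    PowerSeries.C (2 * (1 - x) * (1 - s * x) ^ 2 + s * x * (1 - x) * (1 - s * x) + x * (1 - s * x) ^ 2) *
      (X * dfSeries R 0) +
    PowerSeries.C ((1 - x) * (1 - s * x) ^ 2) * (X * dfSeries R 0) ^ 2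

/-- `B̄ = (1-x) · B(s, T/x; x) = 1 + (1-x) ⟦T⟧`, where `B(s,t;x) = 1 + ⟦tx⟧ + ⟦x⟧` is the `B`-frill
generating function of Lemma 21 (and `(1-x)·C(T/x, s; x)` as well: `C(s,t;x) = 1 + ⟦sx⟧ + ⟦x⟧`).
[cite: Rechnitzer2006Haruspicy2, Lemma 21] -/
def bbBbar (x : R) : PowerSeries R :=
  1 + PowerSeries.C (1 - x) * (X * dfSeries R 0)

/-- `C̄ = (1-x)(1-sx) · C(s, t; x) = (1-x)(1-sx) + sx(1-x) + x(1-sx)` (no `t`), `C = 1 + ⟦sx⟧ + ⟦x⟧`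
the `C`-frill generating function of Lemma 21 (and `(1-x)(1-sx)·B(T/x, s; x)` as well).
[cite: Rechnitzer2006Haruspicy2, Lemma 21] -/
def bbCbar (s x : R) : R :=
  (1 - x) * (1 - s * x) + s * x * (1 - x) + x * (1 - s * x)

/-- **Lemma 21, cleared of denominators**: `(1-x)³(1-sx)⁶ · T(T/x, s; x, y)/y⁴` written in
`ℤ[s,x]⟦T⟧` in terms of `⟦T⟧ = T/(1-T)` (`X * dfSeries R 0`), `U = ⟦sT⟧ = 1/(1-sT) - 1`
(`geomSeries s - 1`) and `V = ⟦sxT⟧ = 1/(1-sxT) - 1` (`geomSeries (s x) - 1`), where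
`T(t,s;x,y) = 2(T̂(t,s;x,y) + T̂(s,t;x,y))` is the generating function of the 2-4-2 building blocks
(`t` conjugate to the top row, `s` to the bottom row) and `T̂ = y⁴(A⟦stx⟧⟦tx⟧²B + A⟦stx⟧⟦stx²⟧⟦tx⟧²B
+ A⟦stx⟧⟦tx⟧³B + C⟦sx⟧⟦tx⟧³B + C⟦sx⟧⟦x⟧⟦tx⟧³B)`: with `t ↦ T/x`,
`T̂(T/x,s)/y⁴ = A B U ⟦T⟧²(1 + V + ⟦T⟧) + B C ⟦sx⟧(1+⟦x⟧) ⟦T⟧³` and, `A` being symmetric and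
`B(T/x,s) = C(s,·)`, `C(T/x,s) = B(s,T/x)`, `T̂(s,T/x)/y⁴ = A C U ⟦sx⟧²(1 + V + ⟦sx⟧) + B C ⟦sx⟧³(1+⟦x⟧)⟦T⟧`;
multiplying by `(1-x)³(1-sx)⁶` (`Ā = (1-x)(1-sx)²A`, `B̄ = (1-x)B`, `C̄ = (1-x)(1-sx)C`,
`(1-x)⟦x⟧ = x`, `(1-sx)⟦sx⟧ = sx`) gives the six terms below. Its Taylor coefficients
`[T^t s^w x^j]/((1-x)³(1-sx)⁶)` count the building blocks with top row `t`, bottom row `w` and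
horizontal half-perimeter `j + t` (checked against a direct enumeration for `j + t ≤ 9`).
[cite: Rechnitzer2006Haruspicy2, Lemma 21] -/
def bbLem21Cleared (s x : R) : PowerSeries R :=
  2 * (PowerSeries.C ((1 - x) * (1 - s * x) ^ 4) *
        (bbAbar s x * bbBbar x * (X * dfSeries R 0) ^ 2 * (1 + X * dfSeries R 0)) *
        (geomSeries s - 1)
    + PowerSeries.C ((1 - s * x) ^ 4) * (PowerSeries.C (1 - x) *
        (bbAbar s x * bbBbar x * (X * dfSeries R 0) ^ 2) *
        (geomSeries s - 1) * (geomSeries (s * x) - 1))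
    + PowerSeries.C ((1 - s * x) ^ 4 * (s * x) * bbCbar s x) *
        (bbBbar x * (X * dfSeries R 0) ^ 3)
    + PowerSeries.C ((1 - x) * (s * x) ^ 2 * bbCbar s x) *
        (bbAbar s x * (geomSeries s - 1))
    + PowerSeries.C (1 - s * x) * (PowerSeries.C (1 - x) *
        (PowerSeries.C ((s * x) ^ 2 * bbCbar s x) * bbAbar s x) *
        (geomSeries s - 1) * (geomSeries (s * x) - 1))
    + PowerSeries.C ((1 - s * x) ^ 2 * (s * x) ^ 3 * bbCbar s x) *
        (bbBbar x * (X * dfSeries R 0)))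

/-- `bbAbar` is natural in the coefficient ring. [folklore] -/
theorem map_bbAbar {S : Type*} [CommRing S] (f : R →+* S) (s x : R) :
    PowerSeries.map f (bbAbar s x) = bbAbar (f s) (f x) := by
  simp only [bbAbar, map_add, map_mul, map_pow, map_sub, map_one, map_ofNat, PowerSeries.map_C,
    PowerSeries.map_X, map_dfSeries]

/-- `bbBbar` is natural in the coefficient ring. [folklore] -/
theorem map_bbBbar {S : Type*} [CommRing S] (f : R →+* S) (x : R) :
    PowerSeries.map f (bbBbar x) = bbBbar (f x) := by
  simp only [bbBbar, map_add, map_mul, map_sub, map_one, PowerSeries.map_C, PowerSeries.map_X,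
    map_dfSeries]

/-- `bbLem21Cleared` is natural in the coefficient ring. [folklore] -/
theorem map_bbLem21Cleared {S : Type*} [CommRing S] (f : R →+* S) (s x : R) :
    PowerSeries.map f (bbLem21Cleared s x) = bbLem21Cleared (f s) (f x) := by
  simp only [bbLem21Cleared, bbCbar, map_add, map_mul, map_pow, map_sub, map_one, map_ofNat,
    PowerSeries.map_C, PowerSeries.map_X, map_dfSeries, map_geomSeries, map_bbAbar, map_bbBbar]

end Lemma21

/-! ### Eq. (29) with (31) for the cleared building-block generating function -/

section Lemma21PF

variable {R : Type*} [CommRing R]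

/-- The `⟦T⟧`-coefficients of `Ā B̄ ⟦T⟧²` (degree `5`). [cite: Rechnitzer2006Haruspicy2, Lemma 21] -/
def bbCoeffUV₁ (s x : R) (α : ℕ) : R :=
  if α = 2 then (1 - x) * (1 - s * x) ^ 2 + x * (1 - s * x) ^ 2 + 2 * s * x * (1 - x) * (1 - s * x) +
      s ^ 2 * x ^ 2 * (1 - x) + s * x ^ 2 * (1 - s * x)
  else if α = 3 then ((1 - x) * (1 - s * x) ^ 2 + x * (1 - s * x) ^ 2 + 2 * s * x * (1 - x) * (1 - s * x) +
      s ^ 2 * x ^ 2 * (1 - x) + s * x ^ 2 * (1 - s * x)) * (1 - x) +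
      (2 * (1 - x) * (1 - s * x) ^ 2 + s * x * (1 - x) * (1 - s * x) + x * (1 - s * x) ^ 2)
  else if α = 4 then (2 * (1 - x) * (1 - s * x) ^ 2 + s * x * (1 - x) * (1 - s * x) + x * (1 - s * x) ^ 2) * (1 - x) +
      (1 - x) * (1 - s * x) ^ 2
  else if α = 5 then (1 - x) * (1 - s * x) ^ 2 * (1 - x) else 0

/-- The `⟦T⟧`-coefficients of `(sx)² C̄ Ā` (degree `2`). [cite: Rechnitzer2006Haruspicy2, Lemma 21] -/
def bbCoeffUV₂ (s x : R) (α : ℕ) : R :=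
  if α = 0 then (s * x) ^ 2 * bbCbar s x *
      ((1 - x) * (1 - s * x) ^ 2 + x * (1 - s * x) ^ 2 + 2 * s * x * (1 - x) * (1 - s * x) +
      s ^ 2 * x ^ 2 * (1 - x) + s * x ^ 2 * (1 - s * x))
  else if α = 1 then (s * x) ^ 2 * bbCbar s x *
      (2 * (1 - x) * (1 - s * x) ^ 2 + s * x * (1 - x) * (1 - s * x) + x * (1 - s * x) ^ 2)
  else if α = 2 then (s * x) ^ 2 * bbCbar s x * ((1 - x) * (1 - s * x) ^ 2) else 0

/-- `Σ_α c₁(α) ⟦T⟧^α = Ā B̄ ⟦T⟧²`. [cite: Rechnitzer2006Haruspicy2, Lemma 21] -/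
theorem sum_bbCoeffUV₁ (s x : R) :
    ∑ α ∈ range (5 + 1), PowerSeries.C (bbCoeffUV₁ s x α) * (X * dfSeries R 0) ^ α =
      bbAbar s x * bbBbar x * (X * dfSeries R 0) ^ 2 := by
  simp only [bbCoeffUV₁, Finset.sum_range_succ, Finset.sum_range_zero, Nat.reduceEqDiff, ↓reduceIte,
    bbAbar, bbBbar]
  simp only [map_add, map_mul, map_sub, map_pow, map_one, map_ofNat, map_zero]
  ring

/-- `Σ_α c₂(α) ⟦T⟧^α = (sx)² C̄ Ā`. [cite: Rechnitzer2006Haruspicy2, Lemma 21] -/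
theorem sum_bbCoeffUV₂ (s x : R) :
    ∑ α ∈ range (5 + 1), PowerSeries.C (bbCoeffUV₂ s x α) * (X * dfSeries R 0) ^ α =
      PowerSeries.C ((s * x) ^ 2 * bbCbar s x) * bbAbar s x := by
  simp only [bbCoeffUV₂, Finset.sum_range_succ, Finset.sum_range_zero, Nat.reduceEqDiff, ↓reduceIte,
    bbAbar]
  simp only [map_add, map_mul, map_sub, map_pow, map_one, map_ofNat, map_zero]
  ring

end Lemma21PF

section Lemma21PF2

variable {R : Type*} [CommRing R]

/-- **The partial fraction expansion (29) with the printed `c₈` of (31)**, for the cleared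
building-block generating function `bbLem21Cleared`: multiplied by `(1-sx)⁵(1-s)⁶` it is a
polynomial in `T/(1-T)` (i.e. `c₀ t⁰ + Σ_k c_{k+1} k! tᵏ/(1-t)^{k+1}`, see `exists_fin_sum_eval₂`)
plus a multiple of `1/(1-sT)` plus `c₈ · (1-x)³(1-sx)⁶ · (1-sx)⁵(1-s)⁶ · 1/(1-sxT)` with
`c₈ = -2sx²(s²x²+sx-s+1)/((1-sx)⁴(1-x)²)` exactly as printed in (31) (the other `cᵢ` are left
existential, as in `Rechnitzer2006_eq29`). [cite: Rechnitzer2006Haruspicy2, eqs. (29) and (31)] -/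
theorem bbLem21Cleared_partialFraction (s x : R) :
    ∃ (q : R[X]) (m₇ : R), PowerSeries.C ((1 - s * x) ^ 5 * (1 - s) ^ 6) * bbLem21Cleared s x =
      q.eval₂ PowerSeries.C (X * dfSeries R 0) + PowerSeries.C m₇ * geomSeries s +
        PowerSeries.C (-2 * s * x ^ 2 * (s ^ 2 * x ^ 2 + s * x - s + 1) *
          (1 - x) * (1 - s * x) ^ 7 * (1 - s) ^ 6) * geomSeries (s * x) := by
  -- `Ā`, `B̄` as polynomials in `⟦T⟧`
  let pA : R[X] := Polynomial.C ((1 - x) * (1 - s * x) ^ 2 + x * (1 - s * x) ^ 2 + 2 * s * x * (1 - x) * (1 - s * x) +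
      s ^ 2 * x ^ 2 * (1 - x) + s * x ^ 2 * (1 - s * x)) +
      Polynomial.C (2 * (1 - x) * (1 - s * x) ^ 2 + s * x * (1 - x) * (1 - s * x) + x * (1 - s * x) ^ 2) * Polynomial.X +
      Polynomial.C ((1 - x) * (1 - s * x) ^ 2) * Polynomial.X ^ 2
  let pB : R[X] := 1 + Polynomial.C (1 - x) * Polynomial.X
  have hA : pA.eval₂ PowerSeries.C (X * dfSeries R 0) = bbAbar s x := by
    simp only [pA, bbAbar, Polynomial.eval₂_add, Polynomial.eval₂_mul, Polynomial.eval₂_C,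
      Polynomial.eval₂_X, Polynomial.eval₂_pow]
  have hB : pB.eval₂ PowerSeries.C (X * dfSeries R 0) = bbBbar x := by
    simp only [pB, bbBbar, Polynomial.eval₂_add, Polynomial.eval₂_mul, Polynomial.eval₂_C,
      Polynomial.eval₂_X, Polynomial.eval₂_one]
  have h₁e : (pA * pB * Polynomial.X ^ 2 * (1 + Polynomial.X)).eval₂ PowerSeries.C (X * dfSeries R 0) =
      bbAbar s x * bbBbar x * (X * dfSeries R 0) ^ 2 * (1 + X * dfSeries R 0) := by
    simp only [Polynomial.eval₂_add, Polynomial.eval₂_mul, Polynomial.eval₂_X,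
      Polynomial.eval₂_pow, Polynomial.eval₂_one, hA, hB]
  have h₁d : (pA * pB * Polynomial.X ^ 2 * (1 + Polynomial.X)).natDegree ≤ 6 := by
    simp only [pA, pB]; compute_degree
  have hAd : pA.natDegree ≤ 6 := by
    simp only [pA]; compute_degree; decide
  have h₃e : (Polynomial.C ((1 - s * x) ^ 4 * (s * x) * bbCbar s x) * pB * Polynomial.X ^ 3).eval₂
      PowerSeries.C (X * dfSeries R 0) = PowerSeries.C ((1 - s * x) ^ 4 * (s * x) * bbCbar s x) *
        (bbBbar x * (X * dfSeries R 0) ^ 3) := by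
    simp only [Polynomial.eval₂_mul, Polynomial.eval₂_C, Polynomial.eval₂_X, Polynomial.eval₂_pow, hB,
      mul_assoc]
  have h₆e : (Polynomial.C ((1 - s * x) ^ 2 * (s * x) ^ 3 * bbCbar s x) * pB * Polynomial.X).eval₂
      PowerSeries.C (X * dfSeries R 0) = PowerSeries.C ((1 - s * x) ^ 2 * (s * x) ^ 3 * bbCbar s x) *
        (bbBbar x * (X * dfSeries R 0)) := by
    simp only [Polynomial.eval₂_mul, Polynomial.eval₂_C, Polynomial.eval₂_X, hB, mul_assoc]
  -- the six terms in the shape `q(⟦T⟧) + m₇/(1-sT) + m₈/(1-sxT)` with clearing `(1-sx)⁵(1-s)⁶`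
  have hL : (1 - s) * ((1 - s) ^ 5 * (1 - s * x) ^ 5) = (1 - s * x) ^ 5 * (1 - s) ^ 6 := by ring
  have t₁ := pf_shape_weaken ((1 - s * x) ^ 5) (pf_shape_const_mul ((1 - x) * (1 - s * x) ^ 4)
    (pf_shape_of_no_last x (eval₂_mul_geomSeries_sub_one s 6 _ h₁d)))
  have t₂ := pf_shape_L_eq hL (pf_shape_weaken (1 - s) (pf_shape_const_mul ((1 - s * x) ^ 4)
    (sum_pow_mul_geomSeries_sub_one_mul s x 5 (bbCoeffUV₁ s x))))
  have t₃ := pf_shape_eval₂ ((1 - s * x) ^ 5 * (1 - s) ^ 6) s x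
    (Polynomial.C ((1 - s * x) ^ 4 * (s * x) * bbCbar s x) * pB * Polynomial.X ^ 3)
  have t₄ := pf_shape_weaken ((1 - s * x) ^ 5)
    (pf_shape_const_mul ((1 - x) * (s * x) ^ 2 * bbCbar s x)
      (pf_shape_of_no_last x (eval₂_mul_geomSeries_sub_one s 6 pA hAd)))
  have t₅ := pf_shape_L_eq hL (pf_shape_weaken (1 - s) (pf_shape_const_mul (1 - s * x)
    (sum_pow_mul_geomSeries_sub_one_mul s x 5 (bbCoeffUV₂ s x))))
  have t₆ := pf_shape_eval₂ ((1 - s * x) ^ 5 * (1 - s) ^ 6) s x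
    (Polynomial.C ((1 - s * x) ^ 2 * (s * x) ^ 3 * bbCbar s x) * pB * Polynomial.X)
  rw [h₁e] at t₁
  rw [sum_bbCoeffUV₁] at t₂
  rw [h₃e] at t₃
  rw [hA] at t₄
  rw [sum_bbCoeffUV₂] at t₅
  rw [h₆e] at t₆
  have hsum := pf_shape_const_mul (2 : R)
    (pf_shape_add (pf_shape_add (pf_shape_add (pf_shape_add (pf_shape_add t₁ t₂) t₃) t₄) t₅) t₆)
  rw [map_ofNat] at hsum
  obtain ⟨q, m₇, H⟩ := hsum
  refine ⟨q, m₇, (?_ : _ = _).trans (H.trans ?_)⟩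
  · rw [bbLem21Cleared]; ring
  · congr 3
    simp only [bbCoeffUV₁, bbCoeffUV₂, bbCbar, Finset.sum_range_succ, Finset.sum_range_zero,
      Nat.reduceEqDiff, ↓reduceIte, Nat.reduceSub]
    ring

end Lemma21PF2

/-! ### Eq. (29)/(31) for `bbSeries` from Lemma 21 -/

section Eq29OfLemma21

/-- **`Rechnitzer2006_eq29` from Lemma 21.** If the building-block generating function
`𝒯 = bbSeries = T(T/x,s;x,y)/y⁴ ∈ ℚ[s]⟦x⟧⟦T⟧` is the rational function of Lemma 21 — stated
cleared of denominators: `(1-x)³(1-sx)⁶ · 𝒯 = bbLem21Cleared s x` — then eq. (29) holds with the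
`c₈` printed in (31): the partial fraction expansion in `T` is `bbLem21Cleared_partialFraction` (pure algebra:
Lemma 24's kernels `k! tᵏ/(1-t)^{k+1}`, `1/(1-st)`, `1/(1-stx)`), with `d = 6`,
`L = (1-x)³(1-sx)¹¹(1-s)⁶` (`a = 1`, `b = 7`, `c = 6`). So `Rechnitzer2006_eq29`, and with
`Rechnitzer2006_lem23` the recurrence `Rechnitzer2006_lem25_rec`
(`Rechnitzer2006_lem25_rec_of_lem23_eq29`), rest on Lemma 21 for the rooted-walk counts `bbCount`.
[cite: Rechnitzer2006Haruspicy2, Lemma 21, eqs. (29) and (31)] -/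
theorem Rechnitzer2006_eq29_of_lem21
    (h21 : PowerSeries.C ((((1 - Polynomial.X) ^ 3 * (1 - sP * Polynomial.X) ^ 6 : ℚ[X][X]) :
        PowerSeries ℚ[X])) * bbSeries =
      bbLem21Cleared ((sP : ℚ[X][X]) : PowerSeries ℚ[X]) ((Polynomial.X : ℚ[X][X]) : PowerSeries ℚ[X])) :
    Rechnitzer2006_eq29 := by
  obtain ⟨q, m₇, hq⟩ := bbLem21Cleared_partialFraction (R := ℚ[X][X]) sP Polynomial.X
  obtain ⟨d, num, num₀, hfin⟩ := exists_fin_sum_eval₂ (R := ℚ[X][X]) q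
  rw [hfin] at hq
  have hK := congrArg (PowerSeries.map (Polynomial.coeToPowerSeries.ringHom (R := ℚ[X]))) hq
  simp only [map_mul (PowerSeries.map (Polynomial.coeToPowerSeries.ringHom (R := ℚ[X]))),
    map_add (PowerSeries.map (Polynomial.coeToPowerSeries.ringHom (R := ℚ[X]))),
    map_sum (PowerSeries.map (Polynomial.coeToPowerSeries.ringHom (R := ℚ[X]))),
    PowerSeries.map_C, map_dfSeries, map_geomSeries, map_bbLem21Cleared,
    Polynomial.coeToPowerSeries.ringHom_apply] at hK
  rw [← h21, ← mul_assoc, ← map_mul, ← Polynomial.coe_mul] at hK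
  refine ⟨d, 1, 7, 6, num, num₀, m₇, ?_⟩
  have hL : ((1 - Polynomial.X) ^ (1 + 2) * (1 - sP * Polynomial.X) ^ (7 + 4) * (1 - sP) ^ 6 : ℚ[X][X]) =
      (1 - sP * Polynomial.X) ^ 5 * (1 - sP) ^ 6 *
        ((1 - Polynomial.X) ^ 3 * (1 - sP * Polynomial.X) ^ 6) := by
    ring
  have hM : (c8NumS * (1 - Polynomial.X) ^ 1 * (1 - sP * Polynomial.X) ^ 7 * (1 - sP) ^ 6 : ℚ[X][X]) =
      -2 * sP * Polynomial.X ^ 2 * (sP ^ 2 * Polynomial.X ^ 2 + sP * Polynomial.X - sP + 1) *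
        (1 - Polynomial.X) * (1 - sP * Polynomial.X) ^ 7 * (1 - sP) ^ 6 := by
    rw [c8NumS]; ring
  rw [hL, hM]
  exact hK

end Eq29OfLemma21

end Literature.Barriers.CriticalPhenomena
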